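import Mathlib.Analysis.SpecialFunctions.Pow.Real
import Mathlib.Analysis.Complex.ExponentialBounds
import Literature.Computability.Complexity.FourierTails
import Literature.Computability.Complexity.CircuitRestriction
import HarnessLib

/-!
# Fourier tails and level-`k` spectral norms of AC⁰ circuits (Tal 2017, Theorems 3.6, 3.8, Cor. 4.8)

Topic `Literature/Computability/Complexity`. This file proves A. Tal's bound on the Fourier
spectrum of bounded-depth circuits (*Tight bounds on the Fourier spectrum of AC⁰*, CCC 2017 /
ECCC TR14-174, Thm. 3.6, Thm. 3.8 = Thm. 1.1, Cor. 4.8(3) — quoted by Raz–Tal, J. ACM 69 (2022),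
as Lemma 7.1) in H21's circuit model, with explicit (unoptimised) absolute constants:

* `Circuit.l1Level_acBasis_le`: for a circuit `C` over `acBasis` (unbounded fan-in `∧`/`∨`,
  negations anywhere and free in `acDepth`) with `acDepth ≤ d` and at most `s ≥ 2` gates,
  `∑_{|S|=k} |Ĉ(S)| ≤ (c · ln s)^{(d-1)k}` for every `k`, `c = talConst = 15 · 8³ · 16896³`.

This is the statement of the named fact `Literature.Computability.QuantumComplexity.Tal2017_fourierL1_ac0` of file
`Literature/Computability/QuantumComplexity/RazTalForrelation` (up to the `rfl`-bridge
`fourierL1Level f = l1Level (χ ∘ f)`), discharged in the file importing both.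

## Architecture (Tal 2017, §3)

* `ACForm n`: layered formulas with the two bottom layers in normal form — `tm` (an `∧`/`∨` of
  literals, height `1`), `nf` (a DNF/CNF, height `2`), `gate` (height `≥ 3`) —, their `eval`,
  `height`, bottom fan-in `width`, and **effective size** `esize` = number of distinct `gate`/`nf`
  subformulas (Tal: gates at distance `≥ 2` from the inputs; a `Finset`, so shared subcircuits of a
  circuit are counted once). `dual` (De Morgan) handles negations.
* `PAssign.restrictInput_toOption`: bridge `restrictInput σ.toOption = σ.apply` between the restriction
  encodings of `CircuitRestriction.lean` and `SwitchingLemma.lean`.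
* `Circuit.exists_acForm` (Thm. 3.8's dummy layer, for straight-line programs `GateList`): a
  circuit over `acBasis` of `acDepth d` and size `s` is a formula of height `≤ d+1`, width `1`,
  `esize ≤ 2s` (each gate and its dual).
* One **switching round** at a leaf `τ` of the common partial decision tree (`ACForm.round`): bottom
  gates are restricted (`restrictTm`), each depth-2 subcircuit is replaced by the CNF/DNF
  (`dtDNF`/`dtCNF`, width `≤ ℓ`) of a depth-`ℓ` decision tree for its restriction (supplied by
  `exists_decisionTree_of_cdt_le` of `SwitchingLemma.lean` through the cleaned DNF `swDNF`), merged
  into its parent; `eval_round`, `height_round_gate` (height drops by one), `esize_round_le`,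
  `width_round_le`.
* `tailWeight_round_le`: Lemma 3.1 (Chebyshev form, `p = 1/(1056 t)`, `D = ⌊kp/4⌋`, threshold
  `2D`) + the multi-switching lemma (`multiSwitching`) + Lemma 3.3 for the common tree
  (`tailWeight_add_procDepth_le`): `W^{≥k}[f] ≤ 2(ε + min(1, (m+1)4^{-(D+1)}))` when the leaves have
  `W^{≥D} ≤ ε`.
* `tailWeight_le_tailBound` (**Theorem 3.6**, induction on the height, base case = the same round
  with `ℓ = 0`): height `≤ d`, `esize ≤ M`, width `≤ t ≤ ℓ = ⌊log₂(M+1)⌋` give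
  `W^{≥k} ≤ 8^d 2^{-k/(16896^d t ℓ^{d-2})}` (Tal: `8^{d-1} 2^{-k/(20t(96 log 2m)^{d-2})}`; our
  constants differ because Lemma 3.1 is used in Chebyshev form and the switching constant is `132`).
* `l1Level_le` (**Cor. 4.8(3)** for formulas, through `l1Level_le_of_tailWeight_le` of
  `FourierTails.lean`), the depth-one computation `l1Level_sgn_all_le_one` (`L_{1,k} ≤ 1` for an
  `∧` of literals: `|f̂(S)| = 2^{1-v}`, `2C(v,k) ≤ 2^v`; needed because Raz–Tal's form
  `(c log s)^{(d-1)k}` of the bound is `1` at depth `1`), and the assembly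
  `Circuit.l1Level_acBasis_le` (absorbing `8^{d+1}`, `2/ln 2`, `16896^{d+1}`, `ℓ ≤ 5 ln s` into
  `c^{(d-1)k}` for `d ≥ 2`, `k ≥ 1`).

## References

* A. Tal, *Tight bounds on the Fourier spectrum of AC⁰*, CCC 2017 / ECCC TR14-174, §3 (Def. 3.4,
  Lemma 3.5, Thm. 3.6, Claim 3.7, Thm. 3.8), Cor. 4.8 [Tal2017].
* J. Håstad, *On the correlation of parity and small-depth circuits*, SIAM J. Comput. 43 (2014),
  Lemma 3.8 [Hastad2014].
* R. Raz, A. Tal, *Oracle separation of BQP and PH*, J. ACM 69 (2022), Lemma 7.1 [RazTalJACM2022].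
* R. O'Donnell, *Analysis of Boolean Functions*, CUP 2014, §1.2 [ODonnell2014].
-/

noncomputable section

namespace Literature.Computability.Complexity

open Finset

variable {n : ℕ}

/-! ### Layered formulas -/

/-- Unbounded fan-in formulas with the two bottom layers in normal form: a `tm` node is an
`∧`/`∨` of literals (height `1`), an `nf` node a DNF/CNF (height `2`, a depth-2 circuit), a
`gate` node an `∧`/`∨` of subformulas (height `≥ 3`). The flag `op = true` means `∨` at the top
(`tm true` = clause, `nf true` = DNF, `gate true` = `∨`-gate). (Not `PropForm` of `CNF.lean`,
which has fan-in `2` and no layer/normal-form structure: Tal's induction is on the height of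
layered unbounded fan-in formulas whose bottom two layers are DNFs/CNFs, reusing `Clause`/`CNF`
of `CNF.lean`; H21's straight-line `Circuit`s are converted by `Circuit.exists_acForm`.)
[cite: Tal2017, §3] -/
inductive ACForm (n : ℕ) : Type
  | tm (op : Bool) (lits : Clause (Fin n)) : ACForm n
  | nf (op : Bool) (cls : CNF (Fin n)) : ACForm n
  | gate (op : Bool) (cs : List (ACForm n)) : ACForm n

namespace ACForm

/-- Instance (classical). [folklore] -/
instance : DecidableEq (ACForm n) := Classical.typeDecidableEq _

/-- Instance (classical). [folklore] -/
instance : Inhabited (ACForm n) := ⟨tm true []⟩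

/-- Combine a list of Booleans by `∨` (`op = true`) or `∧`. [folklore] -/
def combine (op : Bool) (l : List Bool) : Bool := if op then l.any id else l.all id

mutual
/-- The Boolean function computed by a formula. [cite: Tal2017, §3] -/
def eval : ACForm n → (Fin n → Bool) → Bool
  | tm op lits, x => if op then lits.any (Literal.eval x) else lits.all (Literal.eval x)
  | nf op cls, x => if op then cls.evalDNF x else cls.eval x
  | gate op cs, x => combine op (evalList cs x)
/-- The values of a list of formulas. [folklore] -/
def evalList : List (ACForm n) → (Fin n → Bool) → List Bool
  | [], _ => []
  | c :: cs, x => eval c x :: evalList cs x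
end

mutual
/-- The height of a formula: `tm ↦ 1`, `nf ↦ 2`, gates `≥ 3`. [cite: Tal2017, §3] -/
def height : ACForm n → ℕ
  | tm _ _ => 1
  | nf _ _ => 2
  | gate _ cs => max 3 (heightList cs + 1)
/-- The maximal height of a list of formulas. [folklore] -/
def heightList : List (ACForm n) → ℕ
  | [] => 0
  | c :: cs => max (height c) (heightList cs)
end

mutual
/-- The bottom fan-in: the maximal number of literals of a `tm` node or of a clause of an `nf`
node. [cite: Tal2017, §3] -/
def width : ACForm n → ℕ
  | tm _ lits => lits.length
  | nf _ cls => (cls.map List.length).foldr max 0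
  | gate _ cs => widthList cs
/-- The maximal width of a list of formulas. [folklore] -/
def widthList : List (ACForm n) → ℕ
  | [] => 0
  | c :: cs => max (width c) (widthList cs)
end

mutual
/-- The set of `gate` and `nf` subformulas (the gates "at distance `≥ 2` from the inputs", whose
number is Tal's *effective size*). [cite: Tal2017, §3] -/
def subG : ACForm n → Finset (ACForm n)
  | tm _ _ => ∅
  | nf op cls => {nf op cls}
  | gate op cs => insert (gate op cs) (subGList cs)
/-- The union of `subG` over a list. [folklore] -/
def subGList : List (ACForm n) → Finset (ACForm n)
  | [] => ∅
  | c :: cs => subG c ∪ subGList cs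
end

/-- The effective size: the number of distinct `gate`/`nf` subformulas. [cite: Tal2017, §3] -/
def esize (f : ACForm n) : ℕ := (subG f).card

mutual
/-- The set of `nf` subformulas (the depth-2 subcircuits to be switched). [cite: Tal2017, §3] -/
def subNF : ACForm n → Finset (ACForm n)
  | tm _ _ => ∅
  | nf op cls => {nf op cls}
  | gate _ cs => subNFList cs
/-- The union of `subNF` over a list. [folklore] -/
def subNFList : List (ACForm n) → Finset (ACForm n)
  | [] => ∅
  | c :: cs => subNF c ∪ subNFList cs
end

/-! #### Basic lemmas -/

/-- `evalList` is `List.map eval`. [folklore] -/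
@[simp] theorem evalList_eq_map (cs : List (ACForm n)) (x : Fin n → Bool) :
    evalList cs x = cs.map (fun c => eval c x) := by
  induction cs with
  | nil => rfl
  | cons c cs ih => simp [evalList, ih]

/-- `heightList` is the maximum of the heights. [folklore] -/
theorem heightList_eq (cs : List (ACForm n)) : heightList cs = (cs.map height).foldr max 0 := by
  induction cs with
  | nil => rfl
  | cons c cs ih => simp [heightList, ih]

/-- A member is no higher than the list. [folklore] -/
theorem le_heightList_of_mem {cs : List (ACForm n)} {c : ACForm n} (h : c ∈ cs) : height c ≤ heightList cs := by
  induction cs with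
  | nil => simp at h
  | cons c' cs ih =>
    simp only [heightList]
    rcases List.mem_cons.1 h with rfl | h
    · exact le_max_left _ _
    · exact (ih h).trans (le_max_right _ _)

/-- A list is no higher than a common bound. [folklore] -/
theorem heightList_le {cs : List (ACForm n)} {d : ℕ} (h : ∀ c ∈ cs, height c ≤ d) : heightList cs ≤ d := by
  induction cs with
  | nil => simp [heightList]
  | cons c cs ih =>
    simp only [heightList]
    exact max_le (h c (by simp)) (ih fun c' hc' => h c' (by simp [hc']))

/-- A member is no wider than the list. [folklore] -/
theorem le_widthList_of_mem {cs : List (ACForm n)} {c : ACForm n} (h : c ∈ cs) : width c ≤ widthList cs := by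
  induction cs with
  | nil => simp at h
  | cons c' cs ih =>
    simp only [widthList]
    rcases List.mem_cons.1 h with rfl | h
    · exact le_max_left _ _
    · exact (ih h).trans (le_max_right _ _)

/-- A list is no wider than a common bound. [folklore] -/
theorem widthList_le {cs : List (ACForm n)} {t : ℕ} (h : ∀ c ∈ cs, width c ≤ t) : widthList cs ≤ t := by
  induction cs with
  | nil => simp [widthList]
  | cons c cs ih =>
    simp only [widthList]
    exact max_le (h c (by simp)) (ih fun c' hc' => h c' (by simp [hc']))

/-- A maximum is below a common bound. [folklore] -/
theorem foldr_max_le {l : List ℕ} {t : ℕ} (h : ∀ a ∈ l, a ≤ t) : l.foldr max 0 ≤ t := by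
  induction l with
  | nil => simp
  | cons a l ih => simp only [List.foldr_cons]; exact max_le (h a (by simp)) (ih fun b hb => h b (by simp [hb]))

/-- A member is below the maximum. [folklore] -/
theorem le_foldr_max_of_mem {l : List ℕ} {a : ℕ} (h : a ∈ l) : a ≤ l.foldr max 0 := by
  induction l with
  | nil => simp at h
  | cons b l ih =>
    simp only [List.foldr_cons]
    rcases List.mem_cons.1 h with rfl | h
    · exact le_max_left _ _
    · exact (ih h).trans (le_max_right _ _)

/-- The width of a normal form is the maximal clause length. [folklore] -/
theorem width_nf_le_iff {op : Bool} {cls : CNF (Fin n)} {t : ℕ} : width (nf op cls) ≤ t ↔ ∀ c ∈ cls, c.length ≤ t := by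
  simp only [width]
  constructor
  · intro h c hc
    exact (le_foldr_max_of_mem (List.mem_map.2 ⟨c, hc, rfl⟩)).trans h
  · intro h
    exact foldr_max_le fun a ha => by
      obtain ⟨c, hc, rfl⟩ := List.mem_map.1 ha
      exact h c hc

/-- Membership in `subGList`. [folklore] -/
theorem mem_subGList {cs : List (ACForm n)} {u : ACForm n} : u ∈ subGList cs ↔ ∃ c ∈ cs, u ∈ subG c := by
  induction cs with
  | nil => simp [subGList]
  | cons c cs ih => simp [subGList, ih]

/-- Membership in `subNFList`. [folklore] -/
theorem mem_subNFList {cs : List (ACForm n)} {u : ACForm n} : u ∈ subNFList cs ↔ ∃ c ∈ cs, u ∈ subNF c := by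
  induction cs with
  | nil => simp [subNFList]
  | cons c cs ih => simp [subNFList, ih]

/-- `nf` subformulas are `gate`/`nf` subformulas. [folklore] -/
theorem subNF_subset_subG : ∀ f : ACForm n, subNF f ⊆ subG f
  | tm _ _ => by simp [subNF, subG]
  | nf _ _ => by simp [subNF, subG]
  | gate op cs => by
    intro u hu
    simp only [subNF, mem_subNFList] at hu
    obtain ⟨c, hc, hu⟩ := hu
    simp only [subG, Finset.mem_insert, mem_subGList]
    exact Or.inr ⟨c, hc, subNF_subset_subG c hu⟩

/-- Elements of `subNF` are `nf` nodes. [folklore] -/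
theorem exists_eq_nf_of_mem_subNF : ∀ {f u : ACForm n}, u ∈ subNF f → ∃ op cls, u = nf op cls
  | tm _ _, u, h => by simp [subNF] at h
  | nf op cls, u, h => by simp [subNF] at h; exact ⟨op, cls, h⟩
  | gate op cs, u, h => by
    simp only [subNF, mem_subNFList] at h
    obtain ⟨c, _, hu⟩ := h
    exact exists_eq_nf_of_mem_subNF hu

/-- Subformulas of subformulas. [folklore] -/
theorem subG_subset_of_mem : ∀ {f u : ACForm n}, u ∈ subG f → subG u ⊆ subG f
  | tm _ _, u, h => by simp [subG] at h
  | nf op cls, u, h => by simp [subG] at h; subst h; exact le_rfl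
  | gate op cs, u, h => by
    simp only [subG, Finset.mem_insert, mem_subGList] at h
    rcases h with rfl | ⟨c, hc, hu⟩
    · exact le_rfl
    · intro v hv
      simp only [subG, Finset.mem_insert, mem_subGList]
      exact Or.inr ⟨c, hc, subG_subset_of_mem hu hv⟩

/-- The width of an `nf` subformula is at most the width. [folklore] -/
theorem width_le_of_mem_subNF : ∀ {f u : ACForm n}, u ∈ subNF f → width u ≤ width f
  | tm _ _, u, h => by simp [subNF] at h
  | nf op cls, u, h => by simp [subNF] at h; subst h; exact le_rfl
  | gate op cs, u, h => by
    simp only [subNF, mem_subNFList] at h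
    obtain ⟨c, hc, hu⟩ := h
    exact (width_le_of_mem_subNF hu).trans ((le_widthList_of_mem hc).trans (by simp [width]))

/-! ### Duality (De Morgan) -/

mutual
/-- The De Morgan dual: swap `∧`/`∨` and negate the literals; computes the negation. [folklore] -/
def dual : ACForm n → ACForm n
  | tm op lits => tm (!op) (lits.map Literal.negate)
  | nf op cls => nf (!op) (cls.map (List.map Literal.negate))
  | gate op cs => gate (!op) (dualList cs)
/-- `dual` on lists. [folklore] -/
def dualList : List (ACForm n) → List (ACForm n)
  | [] => []
  | c :: cs => dual c :: dualList cs
end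

/-- `dualList` is `map dual`. [folklore] -/
@[simp] theorem dualList_eq_map (cs : List (ACForm n)) : dualList cs = cs.map dual := by
  induction cs with
  | nil => rfl
  | cons c cs ih => simp [dualList, ih]

/-- `∨` of negated literals is the negation of `∧`. [folklore] -/
theorem any_map_negate (lits : Clause (Fin n)) (x : Fin n → Bool) :
    (lits.map Literal.negate).any (Literal.eval x) = !lits.all (Literal.eval x) := by
  rw [List.any_map, List.not_all_eq_any_not]
  congr 1; funext l; simp [Function.comp_apply, Literal.eval_negate]

/-- `∧` of negated literals is the negation of `∨`. [folklore] -/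
theorem all_map_negate (lits : Clause (Fin n)) (x : Fin n → Bool) :
    (lits.map Literal.negate).all (Literal.eval x) = !lits.any (Literal.eval x) := by
  rw [List.all_map, List.not_any_eq_all_not]
  congr 1; funext l; simp [Function.comp_apply, Literal.eval_negate]

/-- `∨` of negated literals, composed form. [folklore] -/
theorem any_comp_negate (lits : Clause (Fin n)) (x : Fin n → Bool) :
    lits.any (Literal.eval x ∘ Literal.negate) = !lits.all (Literal.eval x) := by
  rw [← List.any_map]; exact any_map_negate lits x

/-- `∧` of negated literals, composed form. [folklore] -/
theorem all_comp_negate (lits : Clause (Fin n)) (x : Fin n → Bool) :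
    lits.all (Literal.eval x ∘ Literal.negate) = !lits.any (Literal.eval x) := by
  rw [← List.all_map]; exact all_map_negate lits x

/-- De Morgan for `combine`. [folklore] -/
theorem combine_not_map (op : Bool) (l : List Bool) : combine (!op) (l.map (! ·)) = !combine op l := by
  cases op
  · simp only [combine, Bool.not_false, if_true, Bool.false_eq_true, if_false, List.any_map, List.not_all_eq_any_not]
    congr 1
  · simp only [combine, Bool.not_true, if_true, Bool.false_eq_true, if_false, List.all_map, List.not_any_eq_all_not]
    congr 1

/-- Value of a bottom gate. [folklore] -/
@[simp] theorem eval_tm (op : Bool) (lits : Clause (Fin n)) (x : Fin n → Bool) :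
    (tm op lits).eval x = if op then lits.any (Literal.eval x) else lits.all (Literal.eval x) := by
  rw [eval]

/-- Value of a normal form. [folklore] -/
@[simp] theorem eval_nf (op : Bool) (cls : CNF (Fin n)) (x : Fin n → Bool) :
    (nf op cls).eval x = if op then cls.evalDNF x else cls.eval x := by
  rw [eval]

/-- Value of a gate. [folklore] -/
@[simp] theorem eval_gate (op : Bool) (cs : List (ACForm n)) (x : Fin n → Bool) :
    (gate op cs).eval x = combine op (cs.map fun c => c.eval x) := by
  rw [eval, evalList_eq_map]

mutual
/-- The dual computes the negation. [folklore] -/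
theorem eval_dual : ∀ (f : ACForm n) (x : Fin n → Bool), (dual f).eval x = !f.eval x
  | tm op lits, x => by
    cases op <;> simp [dual, any_comp_negate, all_comp_negate]
  | nf op cls, x => by
    cases op
    · simp only [dual, eval_nf, Bool.not_false, if_true, Bool.false_eq_true, if_false, CNF.evalDNF, CNF.eval,
        List.any_map, List.not_all_eq_any_not]
      congr 1; funext c; simp [Function.comp_apply, all_comp_negate]
    · simp only [dual, eval_nf, Bool.not_true, if_true, Bool.false_eq_true, if_false, CNF.evalDNF, CNF.eval,
        List.all_map, List.not_any_eq_all_not]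
      congr 1; funext c; simp [Function.comp_apply, any_comp_negate]
  | gate op cs, x => by
    rw [dual, eval, eval, evalList_dualList cs x, combine_not_map]
/-- The duals of a list compute the negations. [folklore] -/
theorem evalList_dualList : ∀ (cs : List (ACForm n)) (x : Fin n → Bool),
    evalList (dualList cs) x = (evalList cs x).map (! ·)
  | [], _ => rfl
  | c :: cs, x => by rw [dualList, evalList, evalList, eval_dual c x, evalList_dualList cs x]; rfl
end

mutual
/-- The dual has the same height. [folklore] -/
theorem height_dual : ∀ f : ACForm n, (dual f).height = f.height
  | tm _ _ => rfl
  | nf _ _ => rfl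
  | gate op cs => by rw [dual, height, height, heightList_dualList cs]
/-- `dualList` preserves `heightList`. [folklore] -/
theorem heightList_dualList : ∀ cs : List (ACForm n), heightList (dualList cs) = heightList cs
  | [] => rfl
  | c :: cs => by rw [dualList, heightList, heightList, height_dual c, heightList_dualList cs]
end

mutual
/-- The dual has the same width. [folklore] -/
theorem width_dual : ∀ f : ACForm n, (dual f).width = f.width
  | tm _ _ => by simp [dual, width]
  | nf _ _ => by simp [dual, width, List.map_map, Function.comp_def]
  | gate op cs => by rw [dual, width, width, widthList_dualList cs]
/-- `dualList` preserves `widthList`. [folklore] -/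
theorem widthList_dualList : ∀ cs : List (ACForm n), widthList (dualList cs) = widthList cs
  | [] => rfl
  | c :: cs => by rw [dualList, widthList, widthList, width_dual c, widthList_dualList cs]
end

mutual
/-- Subformulas of the dual are duals of subformulas. [folklore] -/
theorem subG_dual : ∀ f : ACForm n, subG (dual f) = (subG f).image dual
  | tm _ _ => by simp [dual, subG]
  | nf _ _ => by simp [dual, subG]
  | gate op cs => by
    rw [dual, subG, subG, Finset.image_insert, subGList_dualList cs]
    rfl
/-- `dualList` and `subGList`. [folklore] -/
theorem subGList_dualList : ∀ cs : List (ACForm n), subGList (dualList cs) = (subGList cs).image dual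
  | [] => by simp [dualList, subGList]
  | c :: cs => by rw [dualList, subGList, subGList, Finset.image_union, subG_dual c, subGList_dualList cs]
end

/-- The dual has the same effective size (at most). [folklore] -/
theorem esize_dual_le (f : ACForm n) : esize (dual f) ≤ esize f := by
  unfold esize; rw [subG_dual]; exact Finset.card_image_le

end ACForm


namespace ACForm

/-! ### Restricting a bottom gate -/

/-- The restriction of an `∧`/`∨` of literals by `τ`: a constant if some fixed literal absorbs
(`∨` with a true literal, `∧` with a false one), otherwise the same gate on the free literals. [cite: Hastad1986, §2] -/
def restrictTm (τ : PAssign n) (op : Bool) (lits : Clause (Fin n)) : ACForm n :=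
  if ∃ l ∈ lits, l.1 ∈ τ.dom ∧ (τ.val l.1 == l.2) = op then tm (!op) []
  else tm op (lits.filter fun l => l.1 ∉ τ.dom)

/-- A literal on a free variable reads the input. [folklore] -/
theorem literal_eval_apply_of_not_mem {τ : PAssign n} {l : Literal (Fin n)} (h : l.1 ∉ τ.dom) (x : Fin n → Bool) :
    Literal.eval (τ.apply x) l = Literal.eval x l := by
  simp [Literal.eval, PAssign.apply_apply, h]

/-- A literal on a fixed variable reads the fixed value. [folklore] -/
theorem literal_eval_apply_of_mem {τ : PAssign n} {l : Literal (Fin n)} (h : l.1 ∈ τ.dom) (x : Fin n → Bool) :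
    Literal.eval (τ.apply x) l = (τ.val l.1 == l.2) := by
  simp [Literal.eval, PAssign.apply_apply, h]

/-- `restrictTm` computes the restriction. [cite: Hastad1986, §2] -/
theorem eval_restrictTm (τ : PAssign n) (op : Bool) (lits : Clause (Fin n)) (x : Fin n → Bool) :
    (restrictTm τ op lits).eval x = (tm op lits).eval (τ.apply x) := by
  unfold restrictTm
  split_ifs with h
  · obtain ⟨l, hl, hd, hv⟩ := h
    cases op
    · simp only [Bool.not_false, eval_tm, if_true, List.any_nil, Bool.false_eq_true, if_false]
      symm; rw [List.all_eq_false]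
      exact ⟨l, hl, by rw [literal_eval_apply_of_mem hd]; simpa using hv⟩
    · simp only [Bool.not_true, eval_tm, Bool.false_eq_true, if_false, List.all_nil, if_true]
      symm; rw [List.any_eq_true]
      exact ⟨l, hl, by rw [literal_eval_apply_of_mem hd]; exact hv⟩
  · push Not at h
    cases op
    · simp only [eval_tm, Bool.false_eq_true, if_false]
      rw [List.all_filter, Bool.eq_iff_iff, List.all_eq_true, List.all_eq_true]
      constructor
      · intro H l hl
        by_cases hd : l.1 ∈ τ.dom
        · rw [literal_eval_apply_of_mem hd]
          have := h l hl hd; simpa using this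
        · have := H l hl; simp only [hd, not_false_eq_true, decide_true, Bool.not_true] at this
          rw [literal_eval_apply_of_not_mem hd]; simpa using this
      · intro H l hl
        by_cases hd : l.1 ∈ τ.dom
        · simp [hd]
        · have := H l hl; rw [literal_eval_apply_of_not_mem hd] at this; simp [hd, this]
    · simp only [eval_tm, if_true]
      rw [List.any_filter, Bool.eq_iff_iff, List.any_eq_true, List.any_eq_true]
      constructor
      · rintro ⟨l, hl, H⟩
        by_cases hd : l.1 ∈ τ.dom
        · simp [hd] at H
        · refine ⟨l, hl, ?_⟩; rw [literal_eval_apply_of_not_mem hd]; simpa [hd] using H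
      · rintro ⟨l, hl, H⟩
        by_cases hd : l.1 ∈ τ.dom
        · rw [literal_eval_apply_of_mem hd] at H; exact absurd H (by simpa using h l hl hd)
        · refine ⟨l, hl, ?_⟩; rw [literal_eval_apply_of_not_mem hd] at H; simp [hd, H]

/-- `restrictTm` is a bottom gate of no larger width. [folklore] -/
theorem restrictTm_shape (τ : PAssign n) (op : Bool) (lits : Clause (Fin n)) :
    ∃ op' lits', restrictTm τ op lits = tm op' lits' ∧ lits'.length ≤ lits.length := by
  unfold restrictTm
  split_ifs
  · exact ⟨!op, [], rfl, Nat.zero_le _⟩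
  · exact ⟨op, _, rfl, List.length_filter_le _ _⟩

/-! ### Decision trees as DNFs and CNFs -/

/-- The DNF of a decision tree: one term per accepting path. [cite: Tal2017, §3] -/
def dtDNF : DecisionTree n → CNF (Fin n)
  | .leaf true => [[]]
  | .leaf false => []
  | .query i t₀ t₁ => (dtDNF t₀).map (fun c => (i, false) :: c) ++ (dtDNF t₁).map (fun c => (i, true) :: c)

/-- Negating the leaves of a decision tree. [folklore] -/
def dtFlip : DecisionTree n → DecisionTree n
  | .leaf b => .leaf (!b)
  | .query i t₀ t₁ => .query i (dtFlip t₀) (dtFlip t₁)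

/-- The CNF of a decision tree: one clause per rejecting path. [cite: Tal2017, §3] -/
def dtCNF (T : DecisionTree n) : CNF (Fin n) := (dtDNF (dtFlip T)).map (List.map Literal.negate)

/-- The DNF of a decision tree computes it. [cite: Tal2017, §3] -/
theorem evalDNF_dtDNF : ∀ (T : DecisionTree n) (x : Fin n → Bool), (dtDNF T).evalDNF x = T.eval x
  | .leaf true, x => by simp [dtDNF, CNF.evalDNF]
  | .leaf false, x => by simp [dtDNF, CNF.evalDNF]
  | .query i t₀ t₁, x => by
    have h0 := evalDNF_dtDNF t₀ x
    have h1 := evalDNF_dtDNF t₁ x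
    simp only [CNF.evalDNF] at h0 h1
    simp only [dtDNF, CNF.evalDNF, List.any_append, List.any_map, DecisionTree.eval]
    have e0 : ((fun c => List.all c (Literal.eval x)) ∘ fun c => ((i, false) :: c)) =
        fun c => (x i == false) && List.all c (Literal.eval x) := by
      funext c; simp [Literal.eval]
    have e1 : ((fun c => List.all c (Literal.eval x)) ∘ fun c => ((i, true) :: c)) =
        fun c => (x i == true) && List.all c (Literal.eval x) := by
      funext c; simp [Literal.eval]
    rw [e0, e1]
    cases hx : x i <;> simp [h0, h1]

/-- Flipping negates. [folklore] -/
theorem eval_dtFlip : ∀ (T : DecisionTree n) (x : Fin n → Bool), (dtFlip T).eval x = !T.eval x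
  | .leaf b, x => rfl
  | .query i t₀ t₁, x => by
    simp only [dtFlip, DecisionTree.eval]; split_ifs <;> simp [eval_dtFlip]

/-- Flipping keeps the depth. [folklore] -/
theorem depth_dtFlip : ∀ T : DecisionTree n, (dtFlip T).depth = T.depth
  | .leaf _ => rfl
  | .query i t₀ t₁ => by simp [dtFlip, DecisionTree.depth, depth_dtFlip t₀, depth_dtFlip t₁]

/-- The CNF of a decision tree computes it. [cite: Tal2017, §3] -/
theorem eval_dtCNF (T : DecisionTree n) (x : Fin n → Bool) : (dtCNF T).eval x = T.eval x := by
  have h := evalDNF_dtDNF (dtFlip T) x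
  rw [eval_dtFlip] at h
  unfold dtCNF
  simp only [CNF.eval, CNF.evalDNF, List.all_map] at h ⊢
  have : ((fun c => List.any c (Literal.eval x)) ∘ List.map Literal.negate) =
      fun c => !List.all c (Literal.eval x) := by
    funext c; simp [Function.comp_apply, any_comp_negate]
  rw [this, ← List.not_any_eq_all_not, h, Bool.not_not]

/-- Terms of the DNF of a decision tree are no longer than its depth. [cite: Tal2017, §3] -/
theorem length_le_depth_of_mem_dtDNF : ∀ (T : DecisionTree n), ∀ c ∈ dtDNF T, c.length ≤ T.depth
  | .leaf true, c, hc => by simp [dtDNF] at hc; subst hc; simp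
  | .leaf false, c, hc => by simp [dtDNF] at hc
  | .query i t₀ t₁, c, hc => by
    simp only [dtDNF, List.mem_append, List.mem_map] at hc
    simp only [DecisionTree.depth]
    rcases hc with ⟨c', hc', rfl⟩ | ⟨c', hc', rfl⟩
    · have := length_le_depth_of_mem_dtDNF t₀ c' hc'; simp; omega
    · have := length_le_depth_of_mem_dtDNF t₁ c' hc'; simp; omega

/-- Clauses of the CNF of a decision tree are no longer than its depth. [cite: Tal2017, §3] -/
theorem length_le_depth_of_mem_dtCNF (T : DecisionTree n) : ∀ c ∈ dtCNF T, c.length ≤ T.depth := by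
  intro c hc
  unfold dtCNF at hc
  obtain ⟨c', hc', rfl⟩ := List.mem_map.1 hc
  rw [List.length_map, ← depth_dtFlip]
  exact length_le_depth_of_mem_dtDNF _ c' hc'

/-! ### Cleaning a DNF (terms with pairwise distinct variables) -/

/-- Remove duplicate literals; drop the term if it contains complementary literals. [folklore] -/
def cleanTerm (C : Clause (Fin n)) : Option (Clause (Fin n)) :=
  if ∃ l ∈ C, l.negate ∈ C then none else some C.dedup

/-- Clean every term of a DNF (dropping the contradictory ones). [folklore] -/
def cleanDNF (F : CNF (Fin n)) : CNF (Fin n) := F.filterMap cleanTerm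

/-- A term with complementary literals is false. [folklore] -/
theorem all_eq_false_of_compl {C : Clause (Fin n)} {l : Literal (Fin n)} (h1 : l ∈ C) (h2 : l.negate ∈ C)
    (x : Fin n → Bool) : C.all (Literal.eval x) = false := by
  rw [List.all_eq_false]
  by_cases h : Literal.eval x l = true
  · exact ⟨l.negate, h2, by rw [Literal.eval_negate, h]; simp⟩
  · exact ⟨l, h1, by simpa using h⟩

/-- Cleaning preserves the value of a DNF. [folklore] -/
theorem evalDNF_cleanDNF (F : CNF (Fin n)) (x : Fin n → Bool) : (cleanDNF F).evalDNF x = F.evalDNF x := by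
  unfold cleanDNF CNF.evalDNF
  rw [Bool.eq_iff_iff, List.any_eq_true, List.any_eq_true]
  constructor
  · rintro ⟨C', hC', hall⟩
    rw [List.mem_filterMap] at hC'
    obtain ⟨C, hC, hclean⟩ := hC'
    unfold cleanTerm at hclean
    split_ifs at hclean with h
    simp only [Option.some.injEq] at hclean
    subst hclean
    refine ⟨C, hC, ?_⟩
    rw [List.all_eq_true] at hall ⊢
    exact fun l hl => hall l (List.mem_dedup.2 hl)
  · rintro ⟨C, hC, hall⟩
    have hnc : ¬ ∃ l ∈ C, l.negate ∈ C := by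
      rintro ⟨l, h1, h2⟩
      rw [all_eq_false_of_compl h1 h2 x] at hall
      exact Bool.false_ne_true hall
    refine ⟨C.dedup, List.mem_filterMap.2 ⟨C, hC, by simp [cleanTerm, hnc]⟩, ?_⟩
    rw [List.all_eq_true] at hall ⊢
    exact fun l hl => hall l (List.mem_dedup.1 hl)

/-- Cleaned terms have pairwise distinct variables. [folklore] -/
theorem varNodup_of_mem_cleanDNF {F : CNF (Fin n)} {C : Clause (Fin n)} (h : C ∈ cleanDNF F) : VarNodup C := by
  unfold cleanDNF at h
  rw [List.mem_filterMap] at h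
  obtain ⟨C₀, _, hclean⟩ := h
  unfold cleanTerm at hclean
  split_ifs at hclean with hn
  simp only [Option.some.injEq] at hclean
  subst hclean
  unfold VarNodup
  rw [List.Nodup, List.pairwise_map]
  refine List.Pairwise.imp_of_mem ?_ (List.nodup_dedup C₀)
  intro l l' hl hl' hne heq
  apply hn
  rcases l with ⟨i, b⟩; rcases l' with ⟨i', b'⟩
  simp only at heq; subst heq
  have hbb : b' = !b := by
    cases b <;> cases b' <;> simp_all
  subst hbb
  exact ⟨(i, b), List.mem_dedup.1 hl, List.mem_dedup.1 hl'⟩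

/-- Cleaning does not increase the width. [folklore] -/
theorem length_le_of_mem_cleanDNF {F : CNF (Fin n)} {t : ℕ} (hF : ∀ C ∈ F, C.length ≤ t) :
    ∀ C ∈ cleanDNF F, C.length ≤ t := by
  intro C h
  unfold cleanDNF at h
  rw [List.mem_filterMap] at h
  obtain ⟨C₀, hC₀, hclean⟩ := h
  unfold cleanTerm at hclean
  split_ifs at hclean
  simp only [Option.some.injEq] at hclean
  subst hclean
  exact (List.Sublist.length_le (List.dedup_sublist C₀)).trans (hF C₀ hC₀)

/-! ### The DNF handed to the switching lemma for a bottom subformula -/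

/-- The cleaned DNF representing a formula of height `≤ 2` or its negation: a DNF or an `∧`-term
as is, a CNF or an `∨`-clause through its negation. [cite: Tal2017, §3] -/
def swDNF : ACForm n → CNF (Fin n)
  | tm false lits => cleanDNF [lits]
  | tm true lits => cleanDNF [lits.map Literal.negate]
  | nf true cls => cleanDNF cls
  | nf false cls => cleanDNF (cls.map (List.map Literal.negate))
  | gate _ _ => []

/-- Whether `swDNF f` represents `f` (`true`) or its negation. [cite: Tal2017, §3] -/
def swSign : ACForm n → Bool
  | tm op _ => !op
  | nf op _ => op
  | gate _ _ => true

/-- `swDNF f` computes `f` or its negation according to `swSign`. [cite: Tal2017, §3] -/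
theorem evalDNF_swDNF : ∀ (f : ACForm n), f.height ≤ 2 → ∀ x : Fin n → Bool,
    (swDNF f).evalDNF x = (if swSign f then f.eval x else !f.eval x)
  | tm false lits, _, x => by
    show (cleanDNF [lits]).evalDNF x = _
    rw [evalDNF_cleanDNF]; simp [swSign, CNF.evalDNF]
  | tm true lits, _, x => by
    show (cleanDNF [lits.map Literal.negate]).evalDNF x = _
    rw [evalDNF_cleanDNF]; simp [swSign, CNF.evalDNF, all_comp_negate]
  | nf true cls, _, x => by
    show (cleanDNF cls).evalDNF x = _
    rw [evalDNF_cleanDNF]; simp [swSign]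
  | nf false cls, _, x => by
    show (cleanDNF (cls.map (List.map Literal.negate))).evalDNF x = _
    rw [evalDNF_cleanDNF]
    simp only [swSign, eval_nf, Bool.false_eq_true, if_false, CNF.evalDNF, CNF.eval, List.any_map,
      List.not_all_eq_any_not]
    congr 1; funext c; simp [Function.comp_apply, all_comp_negate]
  | gate _ _, h, x => by simp [height] at h

/-- Terms of `swDNF f` have pairwise distinct variables. [folklore] -/
theorem varNodup_swDNF (f : ACForm n) : ∀ C ∈ swDNF f, VarNodup C := by
  intro C hC
  match f, hC with
  | tm false lits, hC => exact varNodup_of_mem_cleanDNF hC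
  | tm true lits, hC => exact varNodup_of_mem_cleanDNF hC
  | nf true cls, hC => exact varNodup_of_mem_cleanDNF hC
  | nf false cls, hC => exact varNodup_of_mem_cleanDNF hC
  | gate _ _, hC => simp [swDNF] at hC

/-- Terms of `swDNF f` are no wider than `f`. [folklore] -/
theorem length_le_width_swDNF (f : ACForm n) : ∀ C ∈ swDNF f, C.length ≤ width f := by
  intro C hC
  match f, hC with
  | tm false lits, hC => exact length_le_of_mem_cleanDNF (fun C h => by simp at h; subst h; simp [width]) C hC
  | tm true lits, hC => exact length_le_of_mem_cleanDNF (fun C h => by simp at h; subst h; simp [width]) C hC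
  | nf true cls, hC => exact length_le_of_mem_cleanDNF (fun C h => (width_nf_le_iff.1 le_rfl) C h) C hC
  | nf false cls, hC =>
    refine length_le_of_mem_cleanDNF (fun C h => ?_) C hC
    obtain ⟨C', hC', rfl⟩ := List.mem_map.1 h
    rw [List.length_map]; exact (width_nf_le_iff.1 le_rfl) C' hC'
  | gate _ _, hC => simp [swDNF] at hC

end ACForm


namespace ACForm

/-! ### One switching round: restrict, replace the depth-2 subcircuits by normal forms of their
decision trees, and merge them into the gates above (Tal 2017, proof of Theorem 3.6) -/

section Round

variable (τ : PAssign n) (ℓ : ℕ)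

/-- `c|τ` has a decision tree of depth `≤ ℓ`. [cite: Tal2017, Definition 3.4] -/
def HasDT (c : ACForm n) : Prop := ∃ T : DecisionTree n, T.depth ≤ ℓ ∧ ∀ x, T.eval x = c.eval (τ.apply x)

open Classical in
/-- A decision tree of depth `≤ ℓ` for `c|τ` (a dummy leaf if there is none). [cite: Tal2017, §3] -/
def dtOf (c : ACForm n) : DecisionTree n :=
  if h : HasDT τ ℓ c then Classical.choose h else .leaf false

/-- The chosen tree has depth `≤ ℓ`. [folklore] -/
theorem depth_dtOf_le (c : ACForm n) : (dtOf τ ℓ c).depth ≤ ℓ := by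
  classical
  unfold dtOf; split_ifs with h
  · exact (Classical.choose_spec h).1
  · exact Nat.zero_le _

/-- The chosen tree computes `c|τ`. [folklore] -/
theorem eval_dtOf {c : ACForm n} (h : HasDT τ ℓ c) (x : Fin n → Bool) : (dtOf τ ℓ c).eval x = c.eval (τ.apply x) := by
  classical
  unfold dtOf; rw [dif_pos h]; exact (Classical.choose_spec h).2 x

/-- The clauses of the `op`-normal form (DNF if `op`, CNF otherwise) of the decision tree of `c|τ`
(Tal: "expressed as a decision tree of depth `≤ ℓ`, hence as a CNF/DNF formula of width `ℓ`"). [cite: Tal2017, Theorem 3.6] -/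
def pieces (op : Bool) (c : ACForm n) : CNF (Fin n) := if op then dtDNF (dtOf τ ℓ c) else dtCNF (dtOf τ ℓ c)

/-- The pieces compute `c|τ`. [cite: Tal2017, Theorem 3.6] -/
theorem eval_nf_pieces {c : ACForm n} (h : HasDT τ ℓ c) (op : Bool) (x : Fin n → Bool) :
    (nf op (pieces τ ℓ op c)).eval x = c.eval (τ.apply x) := by
  cases op
  · simp [pieces, eval_dtCNF, eval_dtOf τ ℓ h]
  · simp [pieces, evalDNF_dtDNF, eval_dtOf τ ℓ h]

/-- The pieces have width `≤ ℓ`. [cite: Tal2017, Theorem 3.6] -/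
theorem length_le_of_mem_pieces (op : Bool) (c : ACForm n) : ∀ C ∈ pieces τ ℓ op c, C.length ≤ ℓ := by
  intro C hC
  cases op
  · simp only [pieces, Bool.false_eq_true, if_false] at hC
    exact (length_le_depth_of_mem_dtCNF _ C hC).trans (depth_dtOf_le τ ℓ c)
  · simp only [pieces, if_true] at hC
    exact (length_le_depth_of_mem_dtDNF _ C hC).trans (depth_dtOf_le τ ℓ c)

/-- The clauses of an `op`-normal form equal to a bottom gate: a matching gate is one clause, a
gate of the same type as the normal form is a list of unit clauses. [folklore] -/
def tmClauses (op : Bool) : ACForm n → CNF (Fin n)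
  | tm op' lits' => if op' = op then lits'.map (fun l => [l]) else [lits']
  | _ => []

/-- `tmClauses` represents the bottom gate. [folklore] -/
theorem eval_nf_tmClauses (op op' : Bool) (lits' : Clause (Fin n)) (x : Fin n → Bool) :
    (nf op (tmClauses op (tm op' lits'))).eval x = (tm op' lits').eval x := by
  unfold tmClauses
  by_cases h : op' = op
  · subst h
    cases op' <;> simp [CNF.evalDNF, CNF.eval, List.any_map, List.all_map, Function.comp_def]
  · cases op <;> cases op' <;> simp_all [CNF.evalDNF, CNF.eval]

/-- Clauses of `tmClauses` are unit clauses or the gate itself. [folklore] -/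
theorem length_le_of_mem_tmClauses (op op' : Bool) (lits' : Clause (Fin n)) :
    ∀ C ∈ tmClauses op (tm op' lits'), C.length ≤ max 1 lits'.length := by
  intro C hC
  simp only [tmClauses] at hC
  split_ifs at hC
  · obtain ⟨l, _, rfl⟩ := List.mem_map.1 hC; simp
  · simp at hC; subst hC; exact le_max_right _ _

/-- The clauses of the merged normal form at a gate all of whose children have height `≤ 2`. [cite: Tal2017, Theorem 3.6] -/
def botClauses (op : Bool) : List (ACForm n) → CNF (Fin n)
  | [] => []
  | tm op' lits :: cs => tmClauses op (restrictTm τ op' lits) ++ botClauses op cs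
  | nf op' cls :: cs => pieces τ ℓ op (nf op' cls) ++ botClauses op cs
  | gate _ _ :: cs => botClauses op cs

mutual
/-- **The round transformation** `f ↦ f'` at a leaf `τ` of the common partial decision tree:
bottom gates are restricted, each depth-2 subcircuit `g` is replaced by the normal form (of the
type of its parent) of a decision tree for `g|τ`, merged into the parent; a gate all of whose
children had height `≤ 2` thereby becomes a depth-2 subcircuit. [cite: Tal2017, Theorem 3.6] -/
def round : ACForm n → ACForm n
  | tm op lits => restrictTm τ op lits
  | nf op cls => nf op cls
  | gate op cs => if heightList cs ≤ 2 then nf op (botClauses τ ℓ op cs) else gate op (roundChildren op cs)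
/-- The new children of a gate of type `op`. [cite: Tal2017, Theorem 3.6] -/
def roundChildren (op : Bool) : List (ACForm n) → List (ACForm n)
  | [] => []
  | tm op' lits :: cs => restrictTm τ op' lits :: roundChildren op cs
  | nf op' cls :: cs => ((pieces τ ℓ op (nf op' cls)).map fun cl => tm (!op) cl) ++ roundChildren op cs
  | gate op' cs' :: cs => round (gate op' cs') :: roundChildren op cs
end

/-- All `nf` subformulas have decision trees under `τ` (the leaf condition of the common tree). [cite: Tal2017, Theorem 3.6] -/
def Good (f : ACForm n) : Prop := ∀ c ∈ subNF f, HasDT τ ℓ c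

/-- Children of a good gate are good. [folklore] -/
theorem Good.of_mem_gate {op : Bool} {cs : List (ACForm n)} (h : Good τ ℓ (gate op cs)) {c : ACForm n} (hc : c ∈ cs) :
    Good τ ℓ c := fun c' hc' => h c' (by simp only [subNF, mem_subNFList]; exact ⟨c, hc, hc'⟩)

/-- `combine` over an appended list. [folklore] -/
theorem combine_append (op : Bool) (l₁ l₂ : List Bool) :
    combine op (l₁ ++ l₂) = combine op [combine op l₁, combine op l₂] := by
  cases op <;> simp [combine]

/-- `combine` over an appended list, nested form. [folklore] -/
theorem combine_append' (op : Bool) (l₁ l₂ : List Bool) :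
    combine op (l₁ ++ l₂) = combine op (combine op l₁ :: l₂) := by
  cases op <;> simp [combine]

/-- `combine` of a cons only depends on the combination of the tail. [folklore] -/
theorem combine_cons_congr (op : Bool) (b : Bool) {l l' : List Bool} (h : combine op l = combine op l') :
    combine op (b :: l) = combine op (b :: l') := by
  cases op <;> simp_all [combine]

/-- The value of the normal form with the pieces of `c` as bottom gates of a gate of type `op`. [folklore] -/
theorem combine_map_pieces {c : ACForm n} (h : HasDT τ ℓ c) (op : Bool) (x : Fin n → Bool) :
    combine op (((pieces τ ℓ op c).map fun cl => tm (!op) cl).map fun c' => c'.eval x) = c.eval (τ.apply x) := by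
  rw [← eval_nf_pieces τ ℓ h op x]
  cases op <;> simp [combine, CNF.evalDNF, CNF.eval, List.map_map, Function.comp_def, List.any_eq, List.all_eq]

/-- The value of an `op`-normal form is `combine op` of the values of its clauses read as bottom gates
of the opposite type. [folklore] -/
theorem eval_nf_eq_combine (op : Bool) (cls : CNF (Fin n)) (x : Fin n → Bool) :
    (nf op cls).eval x = combine op (cls.map fun cl => (tm (!op) cl).eval x) := by
  cases op <;> simp [combine, CNF.evalDNF, CNF.eval, List.any_eq, List.all_eq]

/-- `nf op (A ++ B)` splits. [folklore] -/
theorem eval_nf_append (op : Bool) (A B : CNF (Fin n)) (x : Fin n → Bool) :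
    (nf op (A ++ B)).eval x = combine op [(nf op A).eval x, (nf op B).eval x] := by
  rw [eval_nf_eq_combine, eval_nf_eq_combine, eval_nf_eq_combine, List.map_append, combine_append]

/-- The merged normal form computes the restricted gate. [cite: Tal2017, Theorem 3.6] -/
theorem eval_nf_botClauses (op : Bool) (x : Fin n → Bool) : ∀ (cs : List (ACForm n)), heightList cs ≤ 2 →
    (∀ c ∈ cs, Good τ ℓ c) →
      (nf op (botClauses τ ℓ op cs)).eval x = combine op (cs.map fun c => c.eval (τ.apply x))
  | [], _, _ => by cases op <;> simp [botClauses, combine, CNF.evalDNF, CNF.eval]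
  | tm op' lits :: cs, hh, hg => by
    have ih := eval_nf_botClauses op x cs (le_trans (le_max_right _ _) hh) (fun c hc => hg c (by simp [hc]))
    rw [botClauses, eval_nf_eq_combine, List.map_append, combine_append', ← eval_nf_eq_combine, List.map_cons]
    obtain ⟨op'', lits'', hr, _⟩ := restrictTm_shape τ op' lits
    rw [hr, eval_nf_tmClauses, ← hr, eval_restrictTm]
    apply combine_cons_congr
    rw [← eval_nf_eq_combine, ih]
  | nf op' cls :: cs, hh, hg => by
    have ih := eval_nf_botClauses op x cs (le_trans (le_max_right _ _) hh) (fun c hc => hg c (by simp [hc]))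
    rw [botClauses, eval_nf_eq_combine, List.map_append, combine_append', ← eval_nf_eq_combine, List.map_cons]
    rw [eval_nf_pieces τ ℓ (hg (nf op' cls) (by simp) (nf op' cls) (by simp [subNF])) op x]
    apply combine_cons_congr
    rw [← eval_nf_eq_combine, ih]
  | gate op' cs' :: cs, hh, _ => by
    exfalso
    have : height (gate op' cs') ≤ 2 := (le_max_left _ _).trans hh
    simp [height] at this

mutual
/-- **The round computes the restriction** (for formulas of height `≠ 2`). [cite: Tal2017, Theorem 3.6] -/
theorem eval_round : ∀ (f : ACForm n), Good τ ℓ f → f.height ≠ 2 → ∀ x, (round τ ℓ f).eval x = f.eval (τ.apply x)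
  | tm op lits, _, _, x => by rw [round]; exact eval_restrictTm τ op lits x
  | nf op cls, _, h, _ => absurd rfl h
  | gate op cs, hg, _, x => by
    rw [round]
    split_ifs with hh
    · rw [eval_nf_botClauses τ ℓ op x cs hh (fun c hc => hg.of_mem_gate τ ℓ hc), eval_gate]
    · rw [eval_gate, eval_gate, combine_roundChildren op cs (fun c hc => hg.of_mem_gate τ ℓ hc) x]
/-- The new children of a gate compute, combined, the restricted gate. [cite: Tal2017, Theorem 3.6] -/
theorem combine_roundChildren : ∀ (op : Bool) (cs : List (ACForm n)), (∀ c ∈ cs, Good τ ℓ c) → ∀ x,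
    combine op ((roundChildren τ ℓ op cs).map fun c => c.eval x) = combine op (cs.map fun c => c.eval (τ.apply x))
  | op, [], _, x => rfl
  | op, tm op' lits :: cs, hg, x => by
    have ih := combine_roundChildren op cs (fun c hc => hg c (by simp [hc])) x
    rw [roundChildren, List.map_cons, List.map_cons, eval_restrictTm]
    exact combine_cons_congr op _ ih
  | op, nf op' cls :: cs, hg, x => by
    have ih := combine_roundChildren op cs (fun c hc => hg c (by simp [hc])) x
    rw [roundChildren, List.map_append, combine_append', List.map_cons,
      combine_map_pieces τ ℓ (hg (nf op' cls) (by simp) (nf op' cls) (by simp [subNF])) op x]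
    exact combine_cons_congr op _ ih
  | op, gate op' cs' :: cs, hg, x => by
    have ih := combine_roundChildren op cs (fun c hc => hg c (by simp [hc])) x
    rw [roundChildren, List.map_cons, List.map_cons,
      eval_round (gate op' cs') (hg _ (by simp)) (by simp only [height]; omega) x]
    exact combine_cons_congr op _ ih
end

mutual
/-- **The round lowers the height of gates by one.** [cite: Tal2017, Theorem 3.6] -/
theorem height_round_gate : ∀ (f : ACForm n), 3 ≤ f.height → (round τ ℓ f).height + 1 ≤ f.height
  | tm _ _, h => by simp [height] at h
  | nf _ _, h => by simp [height] at h
  | gate op cs, _ => by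
    rw [round]
    split_ifs with hh
    · simp [height]
    · have ih := heightList_roundChildren op cs
      simp only [height]
      omega
/-- Heights of the new children. [cite: Tal2017, Theorem 3.6] -/
theorem heightList_roundChildren : ∀ (op : Bool) (cs : List (ACForm n)),
    heightList (roundChildren τ ℓ op cs) ≤ max 1 (heightList cs - 1)
  | op, [] => by simp [roundChildren, heightList]
  | op, tm op' lits :: cs => by
    rw [roundChildren, heightList]
    have ih := heightList_roundChildren op cs
    obtain ⟨op'', lits'', hr, _⟩ := restrictTm_shape τ op' lits
    rw [hr]; simp only [height, heightList]; omega
  | op, nf op' cls :: cs => by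
    rw [roundChildren]
    have ih := heightList_roundChildren op cs
    have hp : ∀ c ∈ (pieces τ ℓ op (nf op' cls)).map (fun cl => tm (!op) cl), height c ≤ 1 := by
      intro c hc; obtain ⟨cl, _, rfl⟩ := List.mem_map.1 hc; simp [height]
    have : heightList (((pieces τ ℓ op (nf op' cls)).map fun cl => tm (!op) cl) ++ roundChildren τ ℓ op cs) ≤
        max 1 (heightList (roundChildren τ ℓ op cs)) := by
      refine heightList_le fun c hc => ?_
      rcases List.mem_append.1 hc with hc | hc
      · exact (hp c hc).trans (le_max_left _ _)
      · exact (le_heightList_of_mem hc).trans (le_max_right _ _)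
    simp only [heightList]
    omega
  | op, gate op' cs' :: cs => by
    rw [roundChildren, heightList, heightList]
    have ih := heightList_roundChildren op cs
    have hg := height_round_gate (gate op' cs') (by simp [height])
    omega
end

mutual
/-- **The `gate`/`nf` subformulas after the round are images of old ones.** [cite: Tal2017, Theorem 3.6] -/
theorem subG_round_subset : ∀ (f : ACForm n), 3 ≤ f.height → subG (round τ ℓ f) ⊆ (subG f).image (round τ ℓ)
  | tm _ _, h => by simp [height] at h
  | nf _ _, h => by simp [height] at h
  | gate op cs, _ => by
    intro u hu
    have hr : round τ ℓ (gate op cs) =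
        (if heightList cs ≤ 2 then nf op (botClauses τ ℓ op cs) else gate op (roundChildren τ ℓ op cs)) := by
      rw [round]
    rw [hr] at hu
    by_cases hh : heightList cs ≤ 2
    · rw [if_pos hh] at hu
      simp only [subG, Finset.mem_singleton] at hu
      subst hu
      exact Finset.mem_image.2 ⟨gate op cs, by simp [subG], by rw [hr, if_pos hh]⟩
    · rw [if_neg hh] at hu
      simp only [subG, Finset.mem_insert] at hu
      rcases hu with rfl | hu
      · exact Finset.mem_image.2 ⟨gate op cs, by simp [subG], by rw [hr, if_neg hh]⟩
      · have := subGList_roundChildren_subset op cs hu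
        simp only [subG]
        rw [Finset.image_insert]
        exact Finset.mem_insert_of_mem this
/-- The same for the new children. [cite: Tal2017, Theorem 3.6] -/
theorem subGList_roundChildren_subset : ∀ (op : Bool) (cs : List (ACForm n)),
    subGList (roundChildren τ ℓ op cs) ⊆ (subGList cs).image (round τ ℓ)
  | op, [] => by simp [roundChildren, subGList]
  | op, tm op' lits :: cs => by
    rw [roundChildren, subGList, subGList]
    obtain ⟨op'', lits'', hr, _⟩ := restrictTm_shape τ op' lits
    rw [hr]
    simp only [subG, Finset.empty_union]
    exact subGList_roundChildren_subset op cs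
  | op, nf op' cls :: cs => by
    rw [roundChildren, subGList]
    intro u hu
    rw [mem_subGList] at hu
    obtain ⟨c, hc, hu⟩ := hu
    rcases List.mem_append.1 hc with hc | hc
    · obtain ⟨cl, _, rfl⟩ := List.mem_map.1 hc
      simp [subG] at hu
    · have : u ∈ subGList (roundChildren τ ℓ op cs) := mem_subGList.2 ⟨c, hc, hu⟩
      have := subGList_roundChildren_subset op cs this
      rw [Finset.image_union]
      exact Finset.mem_union_right _ this
  | op, gate op' cs' :: cs => by
    rw [roundChildren, subGList, subGList, Finset.image_union]
    exact Finset.union_subset_union (subG_round_subset (gate op' cs') (by simp [height]))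
      (subGList_roundChildren_subset op cs)
end

/-- **The round does not increase the effective size.** [cite: Tal2017, Theorem 3.6] -/
theorem esize_round_le (f : ACForm n) (h : 3 ≤ f.height) : esize (round τ ℓ f) ≤ esize f :=
  (Finset.card_le_card (subG_round_subset τ ℓ f h)).trans Finset.card_image_le

/-- Clauses of the merged normal form are short. [cite: Tal2017, Theorem 3.6] -/
theorem length_le_of_mem_botClauses (op : Bool) : ∀ (cs : List (ACForm n)),
    ∀ C ∈ botClauses τ ℓ op cs, C.length ≤ max (widthList cs) (max ℓ 1)
  | [], C, hC => by simp [botClauses] at hC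
  | tm op' lits :: cs, C, hC => by
    rw [botClauses] at hC
    simp only [widthList, width]
    rcases List.mem_append.1 hC with hC | hC
    · obtain ⟨op'', lits'', hr, hlen⟩ := restrictTm_shape τ op' lits
      rw [hr] at hC
      have := length_le_of_mem_tmClauses op op'' lits'' C hC
      omega
    · have := length_le_of_mem_botClauses op cs C hC; omega
  | nf op' cls :: cs, C, hC => by
    rw [botClauses] at hC
    simp only [widthList]
    rcases List.mem_append.1 hC with hC | hC
    · have := length_le_of_mem_pieces τ ℓ op _ C hC; omega
    · have := length_le_of_mem_botClauses op cs C hC; omega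
  | gate _ _ :: cs, C, hC => by
    rw [botClauses] at hC
    simp only [widthList]
    have := length_le_of_mem_botClauses op cs C hC; omega

mutual
/-- **The round keeps the bottom fan-in below `max(width, ℓ, 1)`.** [cite: Tal2017, Theorem 3.6] -/
theorem width_round_le : ∀ (f : ACForm n), 3 ≤ f.height → width (round τ ℓ f) ≤ max (width f) (max ℓ 1)
  | tm _ _, h => by simp [height] at h
  | nf _ _, h => by simp [height] at h
  | gate op cs, _ => by
    rw [round]
    split_ifs with hh
    · rw [width_nf_le_iff]
      intro C hC
      exact (length_le_of_mem_botClauses τ ℓ op cs C hC).trans (by simp [width])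
    · simp only [width]
      exact widthList_roundChildren_le op cs
/-- The same for the new children. [cite: Tal2017, Theorem 3.6] -/
theorem widthList_roundChildren_le : ∀ (op : Bool) (cs : List (ACForm n)),
    widthList (roundChildren τ ℓ op cs) ≤ max (widthList cs) (max ℓ 1)
  | op, [] => by simp [roundChildren, widthList]
  | op, tm op' lits :: cs => by
    rw [roundChildren, widthList, widthList]
    have ih := widthList_roundChildren_le op cs
    obtain ⟨op'', lits'', hr, hlen⟩ := restrictTm_shape τ op' lits
    rw [hr]; simp only [width]; omega
  | op, nf op' cls :: cs => by
    rw [roundChildren, widthList]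
    have ih := widthList_roundChildren_le op cs
    refine widthList_le fun c hc => ?_
    rcases List.mem_append.1 hc with hc | hc
    · obtain ⟨cl, hcl, rfl⟩ := List.mem_map.1 hc
      simp only [width]
      have := length_le_of_mem_pieces τ ℓ op _ cl hcl; omega
    · refine (le_widthList_of_mem hc).trans (ih.trans ?_)
      omega
  | op, gate op' cs' :: cs => by
    rw [roundChildren, widthList, widthList]
    have ih := widthList_roundChildren_le op cs
    have hg : width (round τ ℓ (gate op' cs')) ≤ max (widthList cs') (max ℓ 1) := by
      simpa only [width] using width_round_le (gate op' cs') (by simp [height])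
    simp only [width]
    omega
end

end Round

end ACForm


namespace ACForm

/-! ### Theorem 3.6: exponentially small Fourier tails for layered formulas -/

section Tal36

open LowDegree Literature.Probability.RandomGraphs.LowDegree

/-- The `{±1}` reading of a formula. [cite: Tal2017, §2.2] -/
def sgnEval (f : ACForm n) (x : Fin n → Bool) : ℝ := sgn (f.eval x)

/-- `(χ ∘ f)² = 1`. [folklore] -/
theorem sgnEval_sq (f : ACForm n) (x : Fin n → Bool) : sgnEval f x ^ 2 = 1 := by
  unfold sgnEval sgn; split_ifs <;> norm_num

/-- From `cdt (swDNF c) τ ≤ ℓ` to a decision tree for `c|τ`. [cite: Tal2017, Theorem 3.6] -/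
theorem hasDT_of_cdt_le {τ : PAssign n} {ℓ : ℕ} {c : ACForm n} (hc : c.height ≤ 2)
    (h : cdt (swDNF c) τ ≤ ℓ) : HasDT τ ℓ c := by
  obtain ⟨T, hT, hev⟩ := exists_decisionTree_of_cdt_le (varNodup_swDNF c) h
  by_cases hs : swSign c = true
  · refine ⟨T, hT, fun x => ?_⟩
    rw [hev x, evalDNF_swDNF c hc, if_pos hs]
  · refine ⟨dtFlip T, by rw [depth_dtFlip]; exact hT, fun x => ?_⟩
    rw [eval_dtFlip, hev x, evalDNF_swDNF c hc, if_neg hs, Bool.not_not]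

/-- The constant `B₀ = 1056` of the restriction parameter `p = 1/(B₀ t)` (so that
`132 (t+1) p ≤ 1/4`). [cite: Tal2017, Theorem 3.6] -/
def B0 : ℕ := 1056

/-- **One switching round** (the common core of the base case and the induction step of Tal's
Theorem 3.6, with Lemma 3.1 in Chebyshev form, `p = 1/(B₀t)`, `D = ⌊kp/4⌋`, threshold `2D`): if
every `nf` subformula of `f` is among the `G_i` (height `≤ 2`, width `≤ t`, `m'+1 ≤ 2^{ℓ'+1}`), and
at every `τ` where all `cdt (swDNF (G i)) τ ≤ ℓ'` one has `W^{≥D}[f|τ] ≤ ε`, then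
`W^{≥k}[f] ≤ 2(ε + (m'+1) 4^{-(D+1)})` for `k ≥ 16 B₀ t`. [cite: Tal2017, Theorem 3.6] -/
theorem tailWeight_round_le (f : ACForm n) {t : ℕ} (ht : 1 ≤ t) {m' : ℕ} (G : Fin m' → ACForm n)
    (hGw : ∀ i, width (G i) ≤ t) {ℓ' : ℕ} (hm : m' + 1 ≤ 2 ^ (ℓ' + 1))
    {ε : ℝ} (hε : 0 ≤ ε) {k D : ℕ} (hk : 16 * B0 * t ≤ k) (hD : D = k / (4 * B0 * t))
    (hleaf : ∀ τ : PAssign n, (∀ i, cdt (swDNF (G i)) τ ≤ ℓ') → tailWeight (fun x => sgnEval f (τ.apply x)) D ≤ ε) :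
    tailWeight (sgnEval f) k ≤ 2 * (ε + min (1 : ℝ) ((m' + 1 : ℝ) * (1 / 4) ^ (D + 1))) := by
  classical
  unfold B0 at hk hD
  set p : ℝ := 1 / (1056 * t) with hp
  have htpos : (0 : ℝ) < t := by exact_mod_cast ht
  have ht1 : (1 : ℝ) ≤ t := by exact_mod_cast ht
  have hp0 : 0 ≤ p := by rw [hp]; positivity
  have hp1 : p ≤ 1 / 2 := by
    rw [hp, div_le_div_iff₀ (by positivity) (by norm_num)]; nlinarith
  have hp1' : p ≤ 1 := hp1.trans (by norm_num)
  have hDge : 4 ≤ D := by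
    rw [hD, Nat.le_div_iff_mul_le (by omega)]; omega
  have hk' : (16 * 1056 * t : ℝ) ≤ k := by exact_mod_cast hk
  have hkp : (16 : ℝ) ≤ p * k := by
    rw [hp, div_mul_eq_mul_div, one_mul, le_div_iff₀ (by positivity)]; linarith
  have hDk : (D : ℝ) * (4 * 1056 * t) ≤ k := by
    have := Nat.div_mul_le_self k (4 * 1056 * t); rw [← hD] at this; exact_mod_cast this
  have h2D : ((2 * D : ℕ) : ℝ) ≤ p * k / 2 := by
    rw [le_div_iff₀ two_pos, hp, div_mul_eq_mul_div, one_mul, le_div_iff₀ (by positivity)]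
    push_cast; nlinarith
  -- the family of DNFs
  set F : Fin m' → CNF (Fin n) := fun i => swDNF (G i) with hF
  have hFv : ∀ i, ∀ C ∈ F i, VarNodup C := fun i => varNodup_swDNF (G i)
  have hFw : ∀ i, ∀ C ∈ F i, C.length ≤ t := fun i C hC => (length_le_width_swDNF (G i) C hC).trans (hGw i)
  -- Lemma 3.1 (threshold 2D)
  have h31 := tailWeight_le_two_mul_sum_rrWeight (sgnEval f) hp0 hp1' (j := 2 * D) (k := k) fun S hS => by
    refine half_le_sum_subsetWeight_free hp0 hp1' S ?_ ?_
    · have : (k : ℝ) ≤ S.card := by exact_mod_cast hS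
      nlinarith
    · have : (k : ℝ) ≤ S.card := by exact_mod_cast hS
      calc ((2 * D : ℕ) : ℝ) ≤ p * k / 2 := h2D
        _ ≤ p * S.card / 2 := by gcongr
  refine h31.trans (mul_le_mul_of_nonneg_left ?_ zero_le_two)
  -- split the expectation into good and bad restrictions
  set Bad := univ.filter (fun ρ : PAssign n => D + 1 ≤ ccDepth ℓ' F n ρ) with hBad
  have hsplit := Finset.sum_filter_add_sum_filter_not univ (fun ρ : PAssign n => D + 1 ≤ ccDepth ℓ' F n ρ)
    (fun ρ => rrWeight p ρ * tailWeight (fun x => sgnEval f (ρ.apply x)) (2 * D))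
  rw [← hsplit]
  have hTW1 : ∀ ρ : PAssign n, tailWeight (fun x => sgnEval f (ρ.apply x)) (2 * D) ≤ 1 :=
    fun ρ => tailWeight_le_one (fun x => sgnEval_sq f _) _
  have hTW0 : ∀ ρ : PAssign n, 0 ≤ tailWeight (fun x => sgnEval f (ρ.apply x)) (2 * D) :=
    fun ρ => tailWeight_nonneg _ _
  -- bad part
  have hbad1 : ∑ ρ ∈ Bad, rrWeight p ρ * tailWeight (fun x => sgnEval f (ρ.apply x)) (2 * D) ≤ ∑ ρ ∈ Bad, rrWeight p ρ :=
    Finset.sum_le_sum fun ρ _ => mul_le_of_le_one_right (rrWeight_nonneg hp0 hp1' ρ) (hTW1 ρ)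
  have hbad0 : ∑ ρ ∈ Bad, rrWeight p ρ ≤ 1 := by
    rw [← sum_rrWeight (n := n) p]
    exact Finset.sum_le_sum_of_subset_of_nonneg (Finset.subset_univ _) fun ρ _ _ => rrWeight_nonneg hp0 hp1' ρ
  have hbad : ∑ ρ ∈ Bad, rrWeight p ρ * tailWeight (fun x => sgnEval f (ρ.apply x)) (2 * D) ≤
      min (1 : ℝ) ((m' + 1 : ℝ) * (1 / 4) ^ (D + 1)) := by
    refine le_min (hbad1.trans hbad0) ?_
    calc ∑ ρ ∈ Bad, rrWeight p ρ * tailWeight (fun x => sgnEval f (ρ.apply x)) (2 * D)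
        ≤ ∑ ρ ∈ Bad, rrWeight p ρ := hbad1
      _ ≤ (m' + 1 : ℝ) * (132 * (t + 1) * p) ^ (D + 1) := multiSwitching ℓ' F t (D + 1) hFv hFw hm hp0 hp1 (by omega)
      _ ≤ (m' + 1) * (1 / 4) ^ (D + 1) := by
          refine mul_le_mul_of_nonneg_left (pow_le_pow_left₀ (by positivity) ?_ _) (by positivity)
          rw [hp]
          rw [show (132 : ℝ) * (t + 1) * (1 / (1056 * t)) = (t + 1) / (8 * t) by field_simp; ring]
          rw [div_le_div_iff₀ (by positivity) (by norm_num)]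
          nlinarith
  -- good part
  have hgood : ∑ ρ ∈ univ.filter (fun ρ : PAssign n => ¬ D + 1 ≤ ccDepth ℓ' F n ρ),
      rrWeight p ρ * tailWeight (fun x => sgnEval f (ρ.apply x)) (2 * D) ≤ ε := by
    have hpt : ∀ ρ ∈ univ.filter (fun ρ : PAssign n => ¬ D + 1 ≤ ccDepth ℓ' F n ρ),
        rrWeight p ρ * tailWeight (fun x => sgnEval f (ρ.apply x)) (2 * D) ≤ rrWeight p ρ * ε := by
      intro ρ hρ
      simp only [Finset.mem_filter, Finset.mem_univ, true_and, not_le] at hρ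
      refine mul_le_mul_of_nonneg_left ?_ (rrWeight_nonneg hp0 hp1' ρ)
      have hproc := tailWeight_add_procDepth_le (swQuery_subset_free ℓ' F hFv) (sgnEval f) D n ρ
        (ε := ε) fun τ hτ => hleaf τ fun i => cdt_le_of_mem_procLeaves ℓ' F hFv ρ hτ i
      refine le_trans (tailWeight_antitone _ ?_) hproc
      have : ccDepth ℓ' F n ρ = procDepth (swQuery ℓ' F) n ρ := rfl
      omega
    refine (Finset.sum_le_sum hpt).trans ?_
    rw [← Finset.sum_mul]
    calc (∑ ρ ∈ univ.filter (fun ρ : PAssign n => ¬ D + 1 ≤ ccDepth ℓ' F n ρ), rrWeight p ρ) * ε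
        ≤ (∑ ρ : PAssign n, rrWeight p ρ) * ε :=
          mul_le_mul_of_nonneg_right (Finset.sum_le_sum_of_subset_of_nonneg (Finset.subset_univ _)
            fun ρ _ _ => rrWeight_nonneg hp0 hp1' ρ) hε
      _ = ε := by rw [sum_rrWeight, one_mul]
  linarith

/-- The absolute constants of the tail bound: `A = 8`, `B = 16 B₀`. [cite: Tal2017, Theorem 3.6] -/
def cA : ℕ := 8

/-- The absolute constant `B = 16 B₀ = 16896`. [cite: Tal2017, Theorem 3.6] -/
def cB : ℕ := 16 * B0

/-- The tail bound of Theorem 3.6 (variant): `A^d · 2^{-k/(B^d t ℓ^{d-2})}`, written with `exp`. [cite: Tal2017, Theorem 3.6] -/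
def tailBound (ℓ d t k : ℕ) : ℝ :=
  (cA : ℝ) ^ d * Real.exp (-(k * Real.log 2 / ((cB : ℝ) ^ d * t * (ℓ : ℝ) ^ (d - 2))))

/-- The tail bound is positive. [folklore] -/
theorem tailBound_pos (ℓ d t k : ℕ) : 0 < tailBound ℓ d t k := by
  unfold tailBound cA; positivity

/-- `2^{-x}` as `exp`. [folklore] -/
theorem exp_neg_mul_log_two (x : ℝ) : Real.exp (-(x * Real.log 2)) = (2 : ℝ) ^ (-x) := by
  rw [Real.rpow_def_of_pos (by norm_num)]; congr 1; ring

/-- The tail bound decreases in its denominator parameter: monotonicity in the exponent. [folklore] -/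
theorem exp_neg_div_le_exp_neg_div {a T T' : ℝ} (ha : 0 ≤ a) (hT : 0 < T) (hTT' : T ≤ T') :
    Real.exp (-(a / T)) ≤ Real.exp (-(a / T')) := by
  rw [Real.exp_le_exp, neg_le_neg_iff]
  exact div_le_div_of_nonneg_left ha hT hTT'

/-- The tail bound is at least `1` for small `k`: `k ≤ 16 B₀ t` gives `tailBound ≥ 1` (`d ≥ 2`, `ℓ ≥ 1`). [folklore] -/
theorem one_le_tailBound {ℓ d t k : ℕ} (hℓ : 1 ≤ ℓ) (hd : 2 ≤ d) (ht : 1 ≤ t) (hk : k ≤ 16 * B0 * t) :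
    1 ≤ tailBound ℓ d t k := by
  unfold tailBound
  have hA : (2 : ℝ) ≤ (cA : ℝ) ^ d := by
    calc (2 : ℝ) ≤ 8 ^ 1 := by norm_num
      _ ≤ (cA : ℝ) ^ d := by unfold cA; push_cast; exact pow_le_pow_right₀ (by norm_num) (by omega)
  -- the exponent is at most log 2 in absolute value
  have hden : (16 * B0 * t : ℝ) * Real.log 2 ≤ (cB : ℝ) ^ d * t * (ℓ : ℝ) ^ (d - 2) * Real.log 2 := by
    refine mul_le_mul_of_nonneg_right ?_ (Real.log_nonneg one_le_two)
    have h1 : (16 * B0 : ℝ) ≤ (cB : ℝ) ^ d := by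
      calc (16 * B0 : ℝ) = (cB : ℝ) ^ 1 := by unfold cB; push_cast; ring
        _ ≤ (cB : ℝ) ^ d := pow_le_pow_right₀ (by unfold cB B0; norm_num) (by omega)
    have h2 : (1 : ℝ) ≤ (ℓ : ℝ) ^ (d - 2) := one_le_pow₀ (by exact_mod_cast hℓ)
    have htpos : (0 : ℝ) < t := by exact_mod_cast ht
    calc (16 * B0 * t : ℝ) = 16 * B0 * t * 1 := by ring
      _ ≤ (cB : ℝ) ^ d * t * (ℓ : ℝ) ^ (d - 2) := by gcongr
  have hpos : (0 : ℝ) < (cB : ℝ) ^ d * t * (ℓ : ℝ) ^ (d - 2) := by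
    have : (0:ℝ) < t := by exact_mod_cast ht
    have : (0:ℝ) < ℓ := by exact_mod_cast hℓ
    unfold cB B0; positivity
  have hexp : Real.exp (-(Real.log 2)) ≤ Real.exp (-(k * Real.log 2 / ((cB : ℝ) ^ d * t * (ℓ : ℝ) ^ (d - 2)))) := by
    rw [Real.exp_le_exp, neg_le_neg_iff, div_le_iff₀ hpos]
    have hk' : (k : ℝ) ≤ 16 * B0 * t := by exact_mod_cast hk
    calc (k : ℝ) * Real.log 2 ≤ (16 * B0 * t) * Real.log 2 :=
          mul_le_mul_of_nonneg_right hk' (Real.log_nonneg one_le_two)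
      _ ≤ _ := by rw [mul_comm (Real.log 2)]; exact hden
  have hhalf : Real.exp (-(Real.log 2)) = 1 / 2 := by
    rw [Real.exp_neg, Real.exp_log two_pos]; norm_num
  calc (1 : ℝ) = 2 * (1 / 2) := by norm_num
    _ ≤ (cA : ℝ) ^ d * Real.exp (-(k * Real.log 2 / ((cB : ℝ) ^ d * t * (ℓ : ℝ) ^ (d - 2)))) := by
        rw [← hhalf]; exact mul_le_mul hA hexp (by positivity) (by positivity)

/-- The tail bound is monotone in the height parameter. [folklore] -/
theorem tailBound_mono {ℓ d t k : ℕ} (hℓ : 1 ≤ ℓ) (ht : 1 ≤ t) : tailBound ℓ d t k ≤ tailBound ℓ (d + 1) t k := by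
  unfold tailBound
  have htpos : (0:ℝ) < t := by exact_mod_cast ht
  have hℓpos : (0:ℝ) < ℓ := by exact_mod_cast hℓ
  refine mul_le_mul (pow_le_pow_right₀ (by unfold cA; norm_num) (Nat.le_succ d)) ?_ (by positivity) (by positivity)
  refine exp_neg_div_le_exp_neg_div (by positivity) (by unfold cB B0; positivity) ?_
  have h1 : (cB : ℝ) ^ d ≤ (cB : ℝ) ^ (d + 1) := pow_le_pow_right₀ (by unfold cB B0; norm_num) (Nat.le_succ d)
  have h2 : (ℓ : ℝ) ^ (d - 2) ≤ (ℓ : ℝ) ^ (d + 1 - 2) := pow_le_pow_right₀ (by exact_mod_cast hℓ) (by omega)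
  gcongr

end Tal36

end ACForm


namespace ACForm

section Tal36Ind

open LowDegree Literature.Probability.RandomGraphs.LowDegree

/-- The depth parameter of the common trees, `ℓ = ⌊log₂(M+1)⌋` (`M + 1 ≤ 2^{ℓ+1}`). [cite: Tal2017, Theorem 3.6] -/
def logM (M : ℕ) : ℕ := Nat.log 2 (M + 1)

/-- `M + 1 ≤ 2^{ℓ+1}`. [folklore] -/
theorem succ_le_two_pow_logM (M : ℕ) : M + 1 ≤ 2 ^ (logM M + 1) :=
  (Nat.lt_pow_succ_log_self one_lt_two (M + 1)).le

/-- `ℓ ≥ 1` for `M ≥ 1`. [folklore] -/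
theorem one_le_logM {M : ℕ} (hM : 1 ≤ M) : 1 ≤ logM M :=
  Nat.le_log_of_pow_le one_lt_two (by omega)

/-- `(1/4)^{D+1} = e^{-2(D+1) ln 2}`. [folklore] -/
theorem quarter_pow_eq_exp (D : ℕ) : ((1 : ℝ) / 4) ^ (D + 1) = Real.exp (-(2 * (D + 1 : ℕ) * Real.log 2)) := by
  rw [show -(2 * ((D + 1 : ℕ) : ℝ) * Real.log 2) = ((D + 1 : ℕ) : ℝ) * (-(2 * Real.log 2)) by ring, Real.exp_nat_mul]
  congr 1
  rw [Real.exp_neg, show (2 : ℝ) * Real.log 2 = Real.log 4 by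
    rw [show (4 : ℝ) = 2 ^ 2 by norm_num, Real.log_pow]; norm_num, Real.exp_log (by norm_num)]
  norm_num

/-- **Tal's Claim 3.7**: if `X ≤ 1` and `X ≤ 2^{a-b}` with `a ≥ 1` then `X ≤ 2^{1-b/a}`. [cite: Tal2017, Claim 3.7] -/
theorem claim37 {X a b : ℝ} (hX1 : X ≤ 1) (ha : 1 ≤ a) (hX : X ≤ Real.exp ((a - b) * Real.log 2)) :
    X ≤ 2 * Real.exp (-(b / a) * Real.log 2) := by
  have hl2 : 0 < Real.log 2 := Real.log_pos one_lt_two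
  have hapos : 0 < a := by linarith
  rcases le_or_gt b a with hba | hba
  · -- trivial case: the bound is at least `1`
    have : -(1 : ℝ) ≤ -(b / a) := by rw [neg_le_neg_iff, div_le_one hapos]; exact hba
    calc X ≤ 1 := hX1
      _ = 2 * Real.exp (-(1 : ℝ) * Real.log 2) := by
          rw [neg_one_mul, Real.exp_neg, Real.exp_log two_pos]; norm_num
      _ ≤ 2 * Real.exp (-(b / a) * Real.log 2) := by
          refine mul_le_mul_of_nonneg_left (Real.exp_le_exp.2 ?_) zero_le_two
          exact mul_le_mul_of_nonneg_right this hl2.le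
  · refine hX.trans ?_
    rw [show (2 : ℝ) * Real.exp (-(b / a) * Real.log 2) = Real.exp ((1 - b / a) * Real.log 2) by
      rw [sub_mul, one_mul, sub_eq_add_neg, Real.exp_add, Real.exp_log two_pos, neg_mul]]
    refine Real.exp_le_exp.2 (mul_le_mul_of_nonneg_right ?_ hl2.le)
    -- `a - b ≤ 1 - b/a` since `a - b < 0` and `a ≥ 1`
    rw [sub_le_sub_iff]
    have : a - b ≤ (a - b) / a := by
      rw [le_div_iff₀ hapos]; nlinarith
    calc a + b / a = (a - b) + (b + b / a) := by ring
      _ ≤ (a - b) / a + (b + b / a) := by linarith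
      _ = 1 + b := by field_simp; ring

/-- The floor `D = ⌊k/(4B₀t)⌋` in real terms. [folklore] -/
theorem div_le_floor_add_one {k t D : ℕ} (ht : 1 ≤ t) (hD : D = k / (4 * B0 * t)) :
    (k : ℝ) / (4 * B0 * t) ≤ D + 1 ∧ (D : ℝ) ≤ k / (4 * B0 * t) := by
  have htpos : (0:ℝ) < t := by exact_mod_cast ht
  have hpos : (0 : ℝ) < 4 * B0 * t := by unfold B0; push_cast; positivity
  constructor
  · rw [div_le_iff₀ hpos]
    have h := Nat.lt_div_mul_add (a := k) (b := 4 * B0 * t) (by unfold B0; omega)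
    rw [← hD] at h
    have h' : (k : ℝ) < D * (4 * B0 * t) + 4 * B0 * t := by exact_mod_cast h
    have e : ((D : ℝ) + 1) * (4 * B0 * t) = D * (4 * B0 * t) + 4 * B0 * t := by ring
    rw [e]; exact h'.le
  · rw [le_div_iff₀ hpos]
    have := Nat.div_mul_le_self k (4 * B0 * t)
    rw [← hD] at this; exact_mod_cast this

/-- Base-case numerics: `4 · 4^{-(D+1)} ≤ tailBound ℓ 2 t k`. [cite: Tal2017, Theorem 3.6] -/
theorem base_numeric {ℓ t k D : ℕ} (ht : 1 ≤ t) (hD : D = k / (4 * B0 * t)) :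
    2 * (0 + min (1 : ℝ) ((((1 : ℕ) : ℝ) + 1) * (1 / 4) ^ (D + 1))) ≤ tailBound ℓ 2 t k := by
  obtain ⟨hD1, _⟩ := div_le_floor_add_one ht hD
  have hl2 : 0 < Real.log 2 := Real.log_pos one_lt_two
  have htpos : (0:ℝ) < t := by exact_mod_cast ht
  unfold tailBound
  simp only [Nat.sub_self, pow_zero, mul_one, zero_add]
  calc 2 * min (1 : ℝ) ((((1 : ℕ) : ℝ) + 1) * (1 / 4) ^ (D + 1)) ≤ 2 * (2 * (1 / 4) ^ (D + 1)) := by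
        refine mul_le_mul_of_nonneg_left ((min_le_right _ _).trans (by norm_num)) zero_le_two
    _ = 4 * Real.exp (-(2 * (D + 1 : ℕ) * Real.log 2)) := by rw [quarter_pow_eq_exp]; ring
    _ ≤ (cA : ℝ) ^ 2 * Real.exp (-(k * Real.log 2 / ((cB : ℝ) ^ 2 * t))) := by
        refine mul_le_mul (by unfold cA; norm_num) (Real.exp_le_exp.2 ?_) (by positivity) (by positivity)
        rw [neg_le_neg_iff, div_le_iff₀ (by unfold cB B0; positivity)]
        -- k log 2 ≤ 2(D+1) log2 · cB² t, using k ≤ (D+1) 4 B₀ t and cB² ≥ 2 B₀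
        have h1 : (k : ℝ) ≤ (D + 1) * (4 * B0 * t) := by
          rw [div_le_iff₀ (by unfold B0; positivity)] at hD1; exact hD1
        have h2 : (4 * B0 * t : ℝ) ≤ 2 * ((cB : ℝ) ^ 2 * t) := by unfold cB B0; push_cast; nlinarith
        push_cast
        have hD0 : (0:ℝ) ≤ D + 1 := by positivity
        nlinarith [mul_le_mul_of_nonneg_left h2 hD0]

/-- Induction-step numerics: `2(tailBound ℓ d ℓ D + min(1, (M+1)4^{-(D+1)})) ≤ tailBound ℓ (d+1) t k`. [cite: Tal2017, Theorem 3.6] -/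
theorem step_numeric {ℓ d t k D M : ℕ} (hℓ : 1 ≤ ℓ) (hd : 2 ≤ d) (ht : 1 ≤ t) (hM : M + 1 ≤ 2 ^ (ℓ + 1))
    (hD : D = k / (4 * B0 * t)) :
    2 * (tailBound ℓ d ℓ D + min (1 : ℝ) ((M + 1 : ℝ) * (1 / 4) ^ (D + 1))) ≤ tailBound ℓ (d + 1) t k := by
  obtain ⟨hD1, _⟩ := div_le_floor_add_one ht hD
  have hl2 : 0 < Real.log 2 := Real.log_pos one_lt_two
  have htpos : (0:ℝ) < t := by exact_mod_cast ht
  have hℓpos : (0:ℝ) < ℓ := by exact_mod_cast hℓ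
  have hℓ1 : (1:ℝ) ≤ ℓ := by exact_mod_cast hℓ
  have hcB : (cB : ℝ) = 16 * B0 := by unfold cB; push_cast; ring
  have hB0 : (B0 : ℝ) = 1056 := by unfold B0; norm_num
  set T' : ℝ := (cB : ℝ) ^ (d + 1) * t * (ℓ : ℝ) ^ (d + 1 - 2) with hT'
  set X : ℝ := Real.exp (-(k * Real.log 2 / T')) with hX
  have hT'pos : 0 < T' := by rw [hT']; unfold cB B0; positivity
  have hk1 : (k : ℝ) ≤ (D + 1) * (4 * B0 * t) := by
    rw [div_le_iff₀ (by unfold B0; positivity)] at hD1; exact hD1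
  -- (i) the leaf bound
  have hi : tailBound ℓ d ℓ D ≤ (cA : ℝ) ^ d * (2 * X) := by
    unfold tailBound
    refine mul_le_mul_of_nonneg_left ?_ (by positivity)
    set T : ℝ := (cB : ℝ) ^ d * ℓ * (ℓ : ℝ) ^ (d - 2) with hT
    have hTpos : 0 < T := by rw [hT]; unfold cB B0; positivity
    have hT1 : 1 ≤ T := by
      rw [hT]
      have h1 : (1:ℝ) ≤ (cB : ℝ) ^ d := one_le_pow₀ (by unfold cB B0; norm_num)
      have h2 : (1:ℝ) ≤ (ℓ : ℝ) ^ (d - 2) := one_le_pow₀ hℓ1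
      exact one_le_mul_of_one_le_of_one_le (one_le_mul_of_one_le_of_one_le h1 hℓ1) h2
    -- T' = cB^{d+1} t ℓ^{d-1} ≥ 4 B₀ t T  (cB ≥ 4 B₀, ℓ^{d-1} = ℓ · ℓ^{d-2})
    have hTT' : 4 * B0 * t * T ≤ T' := by
      rw [hT, hT', pow_succ, show d + 1 - 2 = (d - 2) + 1 by omega, pow_succ]
      have : (4 * B0 : ℝ) ≤ cB := by rw [hcB]; unfold B0; norm_num
      have h1 : (0:ℝ) ≤ (cB:ℝ) ^ d * t * ((ℓ:ℝ) ^ (d - 2) * ℓ) := by unfold cB B0; positivity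
      calc 4 * B0 * t * ((cB : ℝ) ^ d * ℓ * (ℓ : ℝ) ^ (d - 2)) = (4 * B0) * ((cB : ℝ) ^ d * t * ((ℓ : ℝ) ^ (d - 2) * ℓ)) := by ring
        _ ≤ cB * ((cB : ℝ) ^ d * t * ((ℓ : ℝ) ^ (d - 2) * ℓ)) := mul_le_mul_of_nonneg_right this h1
        _ = (cB : ℝ) ^ d * cB * t * ((ℓ : ℝ) ^ (d - 2) * ℓ) := by ring
    calc Real.exp (-(D * Real.log 2 / T)) ≤ Real.exp ((1 - k / (4 * B0 * t)) * Real.log 2 / T) := by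
          refine Real.exp_le_exp.2 ?_
          rw [show -((D : ℝ) * Real.log 2 / T) = (-(D : ℝ)) * Real.log 2 / T by ring]
          exact div_le_div_of_nonneg_right (mul_le_mul_of_nonneg_right (by linarith) hl2.le) hTpos.le
      _ = Real.exp (Real.log 2 / T) * Real.exp (-(k * Real.log 2 / (4 * B0 * t * T))) := by
          rw [← Real.exp_add]; congr 1; field_simp; ring
      _ ≤ 2 * X := by
          refine mul_le_mul ?_ ?_ (by positivity) zero_le_two
          · calc Real.exp (Real.log 2 / T) ≤ Real.exp (Real.log 2) :=
                  Real.exp_le_exp.2 (div_le_self hl2.le hT1)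
              _ = 2 := Real.exp_log two_pos
          · rw [hX]
            exact exp_neg_div_le_exp_neg_div (by positivity) (by unfold B0; positivity) hTT'
  -- (ii) the failure probability
  have hii : min (1 : ℝ) ((M + 1 : ℝ) * (1 / 4) ^ (D + 1)) ≤ 2 * X := by
    have hM' : (M + 1 : ℝ) ≤ 2 ^ (ℓ + 1) := by exact_mod_cast hM
    have hle : min (1 : ℝ) ((M + 1 : ℝ) * (1 / 4) ^ (D + 1)) ≤ Real.exp (((ℓ + 1 : ℕ) - (2 * (D + 1 : ℕ) : ℝ)) * Real.log 2) := by
      refine (min_le_right _ _).trans ?_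
      rw [quarter_pow_eq_exp, sub_mul, Real.exp_sub]
      rw [show Real.exp (((ℓ + 1 : ℕ) : ℝ) * Real.log 2) = 2 ^ (ℓ + 1) by
        rw [Real.exp_nat_mul, Real.exp_log two_pos]]
      rw [show -(2 * ((D + 1 : ℕ) : ℝ) * Real.log 2) = -((2 * (D + 1 : ℕ) : ℝ) * Real.log 2) by push_cast; ring,
        Real.exp_neg, div_eq_mul_inv]
      exact mul_le_mul_of_nonneg_right hM' (by positivity)
    have h37 := claim37 (min_le_left _ _) (by push_cast; linarith) hle
    refine h37.trans (mul_le_mul_of_nonneg_left ?_ zero_le_two)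
    rw [hX, Real.exp_le_exp]
    -- -(2(D+1)/(ℓ+1)) log 2 ≤ -(k log 2 / T') : need k/T' ≤ 2(D+1)/(ℓ+1)
    rw [neg_mul, neg_le_neg_iff, div_le_iff₀ hT'pos]
    have hfrac : (1 : ℝ) / ℓ ≤ 2 / ((ℓ + 1 : ℕ) : ℝ) := by
      rw [div_le_div_iff₀ hℓpos (by positivity)]; push_cast; linarith
    -- k log2 ≤ (D+1) 4B₀ t log 2 ≤ (D+1) (T'/ℓ) log 2 ≤ (2(D+1)/(ℓ+1)) T' log 2
    have hT'ℓ : (4 * B0 * t * ℓ : ℝ) ≤ T' := by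
      rw [hT', pow_succ, show d + 1 - 2 = (d - 2) + 1 by omega, pow_succ]
      have : (4 * B0 : ℝ) ≤ (cB : ℝ) ^ d * cB := by
        rw [hcB]
        have : (1:ℝ) ≤ (16 * B0 : ℝ) ^ d := one_le_pow₀ (by rw [hB0]; norm_num)
        rw [hB0] at this ⊢; nlinarith
      have h2 : (ℓ : ℝ) ≤ (ℓ : ℝ) ^ (d - 2) * ℓ := by
        have : (1:ℝ) ≤ (ℓ:ℝ) ^ (d - 2) := one_le_pow₀ hℓ1
        nlinarith
      calc (4 * B0 * t * ℓ : ℝ) = (4 * B0) * t * ℓ := by ring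
        _ ≤ ((cB : ℝ) ^ d * cB) * t * ((ℓ : ℝ) ^ (d - 2) * ℓ) := by gcongr
    calc (k : ℝ) * Real.log 2 ≤ (D + 1) * (4 * B0 * t) * Real.log 2 := mul_le_mul_of_nonneg_right hk1 hl2.le
      _ = ((D + 1) / ℓ) * (4 * B0 * t * ℓ) * Real.log 2 := by field_simp
      _ ≤ ((D + 1) / ℓ) * T' * Real.log 2 := by gcongr
      _ = ((D + 1) * (1 / ℓ)) * T' * Real.log 2 := by ring
      _ ≤ ((D + 1) * (2 / ((ℓ + 1 : ℕ) : ℝ))) * T' * Real.log 2 := by gcongr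
      _ = 2 * ((D + 1 : ℕ) : ℝ) / ((ℓ + 1 : ℕ) : ℝ) * Real.log 2 * T' := by push_cast; ring
  -- assemble
  have hA8 : (cA : ℝ) = 8 := by unfold cA; norm_num
  calc 2 * (tailBound ℓ d ℓ D + min (1 : ℝ) ((M + 1 : ℝ) * (1 / 4) ^ (D + 1)))
      ≤ 2 * ((cA : ℝ) ^ d * (2 * X) + 2 * X) := by gcongr
    _ = (4 * (cA : ℝ) ^ d + 4) * X := by ring
    _ ≤ (cA : ℝ) ^ (d + 1) * X := by
        refine mul_le_mul_of_nonneg_right ?_ (by positivity)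
        rw [pow_succ, hA8]
        have : (1 : ℝ) ≤ 8 ^ d := one_le_pow₀ (by norm_num)
        linarith
    _ = tailBound ℓ (d + 1) t k := by rw [tailBound, hX, hT']

/-- **Tal 2017, Theorem 3.6** (variant, explicit constants): a layered formula of height `≤ d`,
effective size `≤ M` and bottom fan-in `≤ t ≤ ℓ = ⌊log₂(M+1)⌋` has
`W^{≥k} ≤ 8^d · 2^{-k/(B^d t ℓ^{d-2})}`, `B = 16896`. (Tal: `8^{d-1} 2^{-k/(20t(96 log 2m)^{d-2})}`.)
Proof: induction on `d`; one switching round (`tailWeight_round_le`) with the `nf` subformulas as the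
family, the leaves handled by the round transformation `round` and the induction hypothesis.
[cite: Tal2017, Theorem 3.6] -/
theorem tailWeight_le_tailBound {M : ℕ} (hM : 1 ≤ M) : ∀ (d : ℕ), 2 ≤ d → ∀ (f : ACForm n) (t : ℕ),
    1 ≤ t → t ≤ logM M → f.height ≤ d → esize f ≤ M → width f ≤ t →
      ∀ k, tailWeight (sgnEval f) k ≤ tailBound (logM M) d t k := by
  have hℓ := one_le_logM hM
  have hpow := succ_le_two_pow_logM M
  intro d hd
  induction d, hd using Nat.le_induction with
  | base =>
    intro f t ht _ hh _ hw k
    by_cases hk : k ≤ 16 * B0 * t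
    · exact (tailWeight_le_one (fun x => sgnEval_sq f x) k).trans (one_le_tailBound hℓ le_rfl ht hk)
    · push Not at hk
      set D := k / (4 * B0 * t) with hD
      have hr := tailWeight_round_le f ht (m' := 1) (fun _ => f) (fun _ => hw) (ℓ' := 0) (by norm_num)
        le_rfl hk.le hD (ε := 0) fun τ hτ => ?_
      · exact hr.trans (base_numeric ht hD)
      · obtain ⟨T, hT, hev⟩ := hasDT_of_cdt_le hh (hτ 0)
        refine le_of_eq (tailWeight_decisionTree_eq_zero sgn T (fun x => by rw [sgnEval, hev x]) ?_)
        have : 4 ≤ D := by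
          unfold B0 at hk hD
          rw [hD, Nat.le_div_iff_mul_le (by omega)]; omega
        omega
  | succ d hd ih =>
    intro f t ht htℓ hh hs hw k
    by_cases hfd : f.height ≤ d
    · exact (ih f t ht htℓ hfd hs hw k).trans (tailBound_mono hℓ ht)
    · push Not at hfd
      have hfh : f.height = d + 1 := le_antisymm hh hfd
      by_cases hk : k ≤ 16 * B0 * t
      · exact (tailWeight_le_one (fun x => sgnEval_sq f x) k).trans (one_le_tailBound hℓ (by omega) ht hk)
      push Not at hk
      set D := k / (4 * B0 * t) with hD
      -- the family of `nf` subformulas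
      set m' := (subNF f).card with hm'
      let e := (subNF f).equivFin
      let G : Fin m' → ACForm n := fun i => (e.symm i).1
      have hGmem : ∀ i, G i ∈ subNF f := fun i => (e.symm i).2
      have hGw : ∀ i, width (G i) ≤ t := fun i => (width_le_of_mem_subNF (hGmem i)).trans hw
      have hm : m' + 1 ≤ 2 ^ (logM M + 1) := by
        have : m' ≤ M := by
          rw [hm']
          exact (Finset.card_le_card (subNF_subset_subG f)).trans hs
        exact le_trans (by omega) hpow
      have hm'M : m' ≤ M := by
        rw [hm']
        exact (Finset.card_le_card (subNF_subset_subG f)).trans hs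
      have hr := tailWeight_round_le f ht G hGw hm (tailBound_pos _ _ _ _).le hk.le hD
        (ε := tailBound (logM M) d (logM M) D) fun τ hτ => ?_
      · refine hr.trans (le_trans ?_ (step_numeric hℓ hd ht hpow hD))
        have hmono : min (1 : ℝ) ((m' + 1 : ℝ) * (1 / 4) ^ (D + 1)) ≤ min (1 : ℝ) ((M + 1 : ℝ) * (1 / 4) ^ (D + 1)) := by
          refine min_le_min le_rfl (mul_le_mul_of_nonneg_right ?_ (by positivity))
          exact_mod_cast Nat.succ_le_succ hm'M
        linarith
      · -- at a leaf: the round transformation and the induction hypothesis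
        have hgood : Good τ (logM M) f := by
          intro c hc
          obtain ⟨op, cls, rfl⟩ := exists_eq_nf_of_mem_subNF hc
          have := hτ (e ⟨_, hc⟩)
          simp only [G, Equiv.symm_apply_apply] at this
          exact hasDT_of_cdt_le (by simp [height]) this
        have h3 : 3 ≤ f.height := by omega
        have hev : (fun x => sgnEval f (τ.apply x)) = sgnEval (round τ (logM M) f) := by
          funext x; rw [sgnEval, sgnEval, eval_round τ (logM M) f hgood (by omega)]
        rw [hev]
        refine ih (round τ (logM M) f) (logM M) hℓ le_rfl ?_ ?_ ?_ D
        · have := height_round_gate τ (logM M) f h3; omega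
        · exact (esize_round_le τ (logM M) f h3).trans hs
        · refine (width_round_le τ (logM M) f h3).trans ?_
          exact max_le (hw.trans htℓ) (max_le le_rfl hℓ)

/-- **Corollary (Tal 2017, Theorem 3.8 / Corollary 4.8(3), for layered formulas)**: a formula of
height `≤ d`, effective size `≤ M` and bottom fan-in `1` has
`L_{1,k} ≤ 8^d (2 B^d ℓ^{d-2}/ln 2)^k` for `k ≥ 1`, `ℓ = ⌊log₂(M+1)⌋`. [cite: Tal2017, Corollary 4.8] -/
theorem l1Level_le {M : ℕ} (hM : 1 ≤ M) {d : ℕ} (hd : 2 ≤ d) (f : ACForm n) (hh : f.height ≤ d)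
    (hs : esize f ≤ M) (hw : width f ≤ 1) {k : ℕ} (hk : 1 ≤ k) :
    l1Level (sgnEval f) k ≤ (cA : ℝ) ^ d * (2 * ((cB : ℝ) ^ d * (logM M : ℝ) ^ (d - 2) / Real.log 2)) ^ k := by
  have hℓ := one_le_logM hM
  have hl2 : 0 < Real.log 2 := Real.log_pos one_lt_two
  have hℓpos : (0:ℝ) < logM M := by exact_mod_cast hℓ
  have hτ : 0 < (cB : ℝ) ^ d * (logM M : ℝ) ^ (d - 2) / Real.log 2 := by unfold cB B0; positivity
  refine l1Level_le_of_tailWeight_le f.eval (C := (cA : ℝ) ^ d) (by positivity) hτ (fun d' => ?_) hk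
  have := tailWeight_le_tailBound hM d hd f 1 le_rfl hℓ hh hs hw d'
  unfold tailBound at this
  simp only [Nat.cast_one, mul_one] at this
  rw [div_div_eq_mul_div]
  exact this

end Tal36Ind

end ACForm


/-! ## From circuits over `acBasis` to layered formulas -/

/-- **Bridge between the two restriction encodings of the tree**: a partial assignment `σ`
(`PAssign`, file `SwitchingLemma`) as an `Option`-valued restriction (`restrictInput`, file
`CircuitRestriction`). [folklore] -/
def PAssign.toOption (σ : PAssign n) : Fin n → Option Bool := fun i => if i ∈ σ.dom then some (σ.val i) else none

/-- `restrictInput σ.toOption = σ.apply`. [folklore] -/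
theorem PAssign.restrictInput_toOption (σ : PAssign n) (x : Fin n → Bool) : restrictInput σ.toOption x = σ.apply x := by
  funext i
  simp only [restrictInput, PAssign.toOption, PAssign.apply_apply]
  split_ifs <;> rfl

namespace ACForm

open GateList

/-- `Literal.negate` is an involution. [folklore] -/
theorem negate_negate (l : Literal (Fin n)) : l.negate.negate = l := by
  rcases l with ⟨i, b⟩; simp [Literal.negate]

mutual
/-- `dual` is an involution. [folklore] -/
theorem dual_dual : ∀ f : ACForm n, dual (dual f) = f
  | tm op lits => by simp [dual, List.map_map, Function.comp_def, negate_negate]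
  | nf op cls => by simp [dual, List.map_map, Function.comp_def, negate_negate]
  | gate op cs => by rw [dual, dual, Bool.not_not, dualList_dualList cs]
/-- `dualList` is an involution. [folklore] -/
theorem dualList_dualList : ∀ cs : List (ACForm n), dualList (dualList cs) = cs
  | [] => rfl
  | c :: cs => by rw [dualList, dualList, dual_dual c, dualList_dualList cs]
end

/-- A gate over given children: a depth-2 normal form if all children are bottom gates, a `gate`
node otherwise (Tal's dummy layer: literals are bottom gates of fan-in `1`). [cite: Tal2017, Theorem 3.8] -/
def mkGate (op : Bool) (cs : List (ACForm n)) : ACForm n :=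
  if heightList cs ≤ 1 then nf op (cs.flatMap (tmClauses op)) else gate op cs

/-- A formula of height `≤ 1` is a bottom gate. [folklore] -/
theorem exists_eq_tm_of_height_le_one : ∀ {c : ACForm n}, c.height ≤ 1 → ∃ op lits, c = tm op lits
  | tm op lits, _ => ⟨op, lits, rfl⟩
  | nf _ _, h => by simp [height] at h
  | gate _ _, h => by simp [height] at h

/-- The merged normal form over bottom gates computes the gate. [folklore] -/
theorem eval_nf_flatMap_tmClauses (op : Bool) (x : Fin n → Bool) : ∀ (cs : List (ACForm n)), heightList cs ≤ 1 →
    (nf op (cs.flatMap (tmClauses op))).eval x = combine op (cs.map fun c => c.eval x)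
  | [], _ => by cases op <;> simp [combine, CNF.evalDNF, CNF.eval]
  | c :: cs, h => by
    have hc : c.height ≤ 1 := (le_max_left _ _).trans h
    obtain ⟨op', lits, rfl⟩ := exists_eq_tm_of_height_le_one hc
    rw [List.flatMap_cons, eval_nf_eq_combine, List.map_append, combine_append', ← eval_nf_eq_combine,
      eval_nf_tmClauses, List.map_cons]
    apply combine_cons_congr
    rw [← eval_nf_eq_combine, eval_nf_flatMap_tmClauses op x cs ((le_max_right _ _).trans h)]

/-- `mkGate` computes the gate. [folklore] -/
theorem eval_mkGate (op : Bool) (cs : List (ACForm n)) (x : Fin n → Bool) :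
    (mkGate op cs).eval x = combine op (cs.map fun c => c.eval x) := by
  unfold mkGate
  split_ifs with h
  · exact eval_nf_flatMap_tmClauses op x cs h
  · exact eval_gate op cs x

/-- The height of `mkGate`. [folklore] -/
theorem height_mkGate_le (op : Bool) (cs : List (ACForm n)) : (mkGate op cs).height ≤ max 2 (heightList cs + 1) := by
  unfold mkGate
  split_ifs with h
  · simp [height]
  · simp only [height]; omega

/-- `mkGate` has bottom fan-in `1` if its children do. [folklore] -/
theorem width_mkGate_le (op : Bool) {cs : List (ACForm n)} (hw : ∀ c ∈ cs, width c ≤ 1) : (mkGate op cs).width ≤ 1 := by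
  unfold mkGate
  split_ifs with h
  · rw [width_nf_le_iff]
    intro C hC
    rw [List.mem_flatMap] at hC
    obtain ⟨c, hc, hC⟩ := hC
    obtain ⟨op', lits, rfl⟩ := exists_eq_tm_of_height_le_one ((le_heightList_of_mem hc).trans h)
    have := length_le_of_mem_tmClauses op op' lits C hC
    have hl : lits.length ≤ 1 := by simpa [width] using hw _ hc
    omega
  · simp only [width]; exact widthList_le hw

/-- The `gate`/`nf` subformulas of `mkGate`. [folklore] -/
theorem subG_mkGate_subset (op : Bool) (cs : List (ACForm n)) : subG (mkGate op cs) ⊆ insert (mkGate op cs) (subGList cs) := by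
  unfold mkGate
  split_ifs with h
  · simp [subG]
  · simp [subG]

/-- `combine` over `List.ofFn`. [folklore] -/
theorem combine_ofFn {k : ℕ} (op : Bool) (f : Fin k → Bool) :
    combine op (List.ofFn f) = if op then decide (∃ i, f i = true) else decide (∀ i, f i = true) := by
  cases op
  · simp only [combine, Bool.false_eq_true, if_false]
    rw [Bool.eq_iff_iff, List.all_eq_true, decide_eq_true_iff]
    simp
  · simp only [combine, if_true]
    rw [Bool.eq_iff_iff, List.any_eq_true, decide_eq_true_iff]
    constructor
    · rintro ⟨a, ha, hp⟩
      obtain ⟨i, rfl⟩ := (List.mem_ofFn' _ _).1 ha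
      exact ⟨i, hp⟩
    · rintro ⟨i, hp⟩
      exact ⟨_, (List.mem_ofFn' _ _).2 ⟨i, rfl⟩, hp⟩

/-- The form of an input literal `xᵢ`: a bottom `∧`-gate of fan-in `1`. [cite: Tal2017, Theorem 3.8] -/
def inputForm (i : Fin n) : ACForm n := tm false [(i, true)]

/-- The form of a wire, given the forms of the gates. [folklore] -/
def wireForm (φ : ℕ → ACForm n) : Fin n ⊕ ℕ → ACForm n
  | .inl i => inputForm i
  | .inr m => φ m

/-- The input form computes the input bit. [folklore] -/
@[simp] theorem eval_inputForm (i : Fin n) (x : Fin n → Bool) : (inputForm i).eval x = x i := by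
  simp [inputForm, Literal.eval]

/-- The set of forms (and their duals) of the first `j` gates. [folklore] -/
def formSet (φ : ℕ → ACForm n) (j : ℕ) : Finset (ACForm n) :=
  (Finset.range j).biUnion fun m => {φ m, dual (φ m)}

/-- Membership in `formSet`. [folklore] -/
theorem mem_formSet {φ : ℕ → ACForm n} {j : ℕ} {u : ACForm n} : u ∈ formSet φ j ↔ ∃ m < j, u = φ m ∨ u = dual (φ m) := by
  simp [formSet]

/-- `formSet` is monotone. [folklore] -/
theorem formSet_mono {φ : ℕ → ACForm n} {j j' : ℕ} (h : j ≤ j') : formSet φ j ⊆ formSet φ j' := by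
  intro u hu; rw [mem_formSet] at hu ⊢
  obtain ⟨m, hm, hu⟩ := hu; exact ⟨m, by omega, hu⟩

/-- `formSet` is closed under `dual`. [folklore] -/
theorem dual_mem_formSet {φ : ℕ → ACForm n} {j : ℕ} {u : ACForm n} (hu : u ∈ formSet φ j) : dual u ∈ formSet φ j := by
  rw [mem_formSet] at hu ⊢
  obtain ⟨m, hm, rfl | rfl⟩ := hu
  · exact ⟨m, hm, Or.inr rfl⟩
  · exact ⟨m, hm, Or.inl (dual_dual _)⟩

/-- `formSet φ j` has at most `2j` elements. [folklore] -/
theorem card_formSet_le (φ : ℕ → ACForm n) (j : ℕ) : (formSet φ j).card ≤ 2 * j := by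
  unfold formSet
  refine (Finset.card_biUnion_le).trans ?_
  calc ∑ m ∈ Finset.range j, ({φ m, dual (φ m)} : Finset (ACForm n)).card ≤ ∑ _m ∈ Finset.range j, 2 :=
        Finset.sum_le_sum fun m _ => Finset.card_le_two
    _ = 2 * j := by simp [mul_comm]

/-- `formSet φ j` only depends on `φ` below `j`. [folklore] -/
theorem formSet_congr {φ φ' : ℕ → ACForm n} {j : ℕ} (h : ∀ m < j, φ' m = φ m) : formSet φ' j = formSet φ j := by
  unfold formSet
  exact Finset.biUnion_congr rfl fun m hm => by rw [h m (Finset.mem_range.1 hm)]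

/-- **Straight-line programs over `acBasis` as layered formulas**: every gate of a well-formed
program over `acBasis` is computed by a formula of bottom fan-in `1`, height at most its
`acWeight`-depth plus one (Tal's dummy layer), all of whose `gate`/`nf` subformulas are forms of
earlier gates or their duals (so that the effective size is at most twice the number of gates). [cite: Tal2017, Theorem 3.8] -/
theorem exists_forms (ms : List (Gate (Fin n))) (hwf : WF ms) (hB : ∀ g ∈ ms, g.fn ∈ acBasis) :
    ∃ φ : ℕ → ACForm n, ∀ m < ms.length,
      (∀ x, (φ m).eval x = (vals ms x).getD m false) ∧
      (φ m).height ≤ (wdepths acWeight ms).getD m 0 + 1 ∧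
      (φ m).width ≤ 1 ∧ subG (φ m) ⊆ formSet φ (m + 1) := by
  classical
  induction ms using List.reverseRecOn with
  | nil => exact ⟨fun _ => tm true [], fun m hm => absurd hm (by simp)⟩
  | append_singleton ms g ih =>
    obtain ⟨φ, hφ⟩ := ih hwf.of_append_left fun g hg => hB g (List.mem_append_left _ hg)
    have hgB : g.fn ∈ acBasis := hB g (by simp)
    have hgOK : GateOK ms.length g := hwf.gateOK_mid (post := [])
    -- properties of the forms of the argument wires
    have hwire : ∀ u : Fin n ⊕ ℕ, OutOK ms.length u →
        (∀ x, (wireForm φ u).eval x = wireOf x (vals ms x) u) ∧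
        (wireForm φ u).height ≤ wireDepthOf (wdepths acWeight ms) u + 1 ∧
        (wireForm φ u).width ≤ 1 ∧ subG (wireForm φ u) ⊆ formSet φ ms.length := by
      rintro (i | m) hu
      · refine ⟨fun x => by simp [wireForm], by simp [wireForm, inputForm, height], by simp [wireForm, inputForm, width], ?_⟩
        simp [wireForm, inputForm, subG]
      · have hm : m < ms.length := hu m rfl
        obtain ⟨h1, h2, h3, h4⟩ := hφ m hm
        exact ⟨h1, h2, h3, h4.trans (formSet_mono (by omega))⟩
    -- the new form `ψ` and the updated assignment
    have finish : ∀ ψ : ACForm n,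
        (∀ x, ψ.eval x = g.op fun a => wireOf x (vals ms x) (g.args a)) →
        ψ.height ≤ (acWeight g.fn + Finset.univ.sup fun a => wireDepthOf (wdepths acWeight ms) (g.args a)) + 1 →
        ψ.width ≤ 1 → subG ψ ⊆ insert ψ (formSet φ ms.length) →
        ∃ φ' : ℕ → ACForm n, ∀ m < (ms ++ [g]).length,
          (∀ x, (φ' m).eval x = (vals (ms ++ [g]) x).getD m false) ∧
          (φ' m).height ≤ (wdepths acWeight (ms ++ [g])).getD m 0 + 1 ∧
          (φ' m).width ≤ 1 ∧ subG (φ' m) ⊆ formSet φ' (m + 1) := by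
      intro ψ hev hht hwd hsub
      refine ⟨fun m => if m = ms.length then ψ else φ m, fun m hm => ?_⟩
      simp only [List.length_append, List.length_singleton] at hm
      have hcongr : ∀ j ≤ ms.length, formSet (fun m => if m = ms.length then ψ else φ m) j = formSet φ j :=
        fun j hj => formSet_congr fun m hm => by rw [if_neg (by omega)]
      by_cases hmL : m = ms.length
      · dsimp only
        rw [if_pos hmL]
        refine ⟨fun x => ?_, ?_, hwd, ?_⟩
        · rw [hev, hmL, getD_vals_append_singleton]
        · rw [hmL, getD_wdepths_append_singleton]; exact hht
        · intro u hu
          have hu' := hsub hu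
          rw [Finset.mem_insert] at hu'
          rw [mem_formSet]
          rcases hu' with rfl | hu'
          · exact ⟨ms.length, by omega, Or.inl (by simp)⟩
          · rw [mem_formSet] at hu'
            obtain ⟨m', hm', h⟩ := hu'
            refine ⟨m', by omega, ?_⟩
            simp only [if_neg (by omega : m' ≠ ms.length)]; exact h
      · have hm' : m < ms.length := by omega
        simp only [if_neg hmL]
        obtain ⟨h1, h2, h3, h4⟩ := hφ m hm'
        refine ⟨fun x => ?_, ?_, h3, ?_⟩
        · rw [h1]
          have := wireOf_vals_append ms [g] x (.inr m) (fun m'' h => by cases h; exact hm')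
          simpa using this.symm
        · have := wireDepthOf_wdepths_append acWeight ms [g] (.inr m) (fun m'' h => by cases h; exact hm')
          simp only [wireDepthOf_inr] at this
          rw [this]; exact h2
        · rw [hcongr (m + 1) (by omega)]; exact h4
    -- case analysis on the gate type
    rcases (mem_acBasis_iff _).1 hgB with hc | ⟨k, hc | hc⟩
    · -- `¬` gate
      obtain ⟨u, rfl⟩ := exists_eq_notGate_of_fn_eq hc
      have hu : OutOK ms.length u := fun m hm => hgOK (0 : Fin 1) m hm
      obtain ⟨h1, h2, h3, h4⟩ := hwire u hu
      refine finish (dual (wireForm φ u)) (fun x => ?_) ?_ ?_ ?_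
      · rw [eval_dual, h1]; rfl
      · rw [height_dual, notGate_fn, acWeight_not, zero_add]
        refine h2.trans ?_
        simp only [notGate]
        rw [Finset.sup_const Finset.univ_nonempty]
      · rw [width_dual]; exact h3
      · rw [subG_dual]
        intro v hv
        obtain ⟨v', hv', rfl⟩ := Finset.mem_image.1 hv
        exact Finset.mem_insert_of_mem (dual_mem_formSet (h4 hv'))
    · -- `∧ₖ` gate
      obtain ⟨args, rfl⟩ := Gate.exists_eq_of_fn_eq hc
      have hargs : ∀ a : Fin k, OutOK ms.length (args a) := fun a m hm => hgOK a m hm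
      set cs := List.ofFn fun a => wireForm φ (args a) with hcs
      have hfun : ∀ x, (fun a => (wireForm φ (args a)).eval x) = fun a => wireOf x (vals ms x) (args a) :=
        fun x => funext fun a => (hwire _ (hargs a)).1 x
      refine finish (mkGate false cs) (fun x => ?_) ?_ ?_ ?_
      · rw [eval_mkGate, hcs, List.map_ofFn]
        change combine false (List.ofFn fun a => (wireForm φ (args a)).eval x) = _
        rw [hfun x, combine_ofFn]; rfl
      · refine (height_mkGate_le false cs).trans ?_
        show max 2 (heightList cs + 1) ≤ acWeight (GateFn.and k) + (Finset.univ.sup fun a => wireDepthOf (wdepths acWeight ms) (args a)) + 1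
        rw [acWeight_and]
        have : heightList cs ≤ (Finset.univ.sup fun a => wireDepthOf (wdepths acWeight ms) (args a)) + 1 := by
          refine heightList_le fun c hc => ?_
          rw [hcs, List.mem_ofFn] at hc
          obtain ⟨a, rfl⟩ := hc
          refine (hwire _ (hargs a)).2.1.trans (Nat.add_le_add_right ?_ 1)
          exact Finset.le_sup (f := fun a => wireDepthOf (wdepths acWeight ms) (args a)) (Finset.mem_univ a)
        omega
      · refine width_mkGate_le false fun c hc => ?_
        rw [hcs, List.mem_ofFn] at hc
        obtain ⟨a, rfl⟩ := hc
        exact (hwire _ (hargs a)).2.2.1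
      · refine (subG_mkGate_subset false cs).trans (Finset.insert_subset_insert _ fun v hv => ?_)
        rw [mem_subGList] at hv
        obtain ⟨c, hc, hv⟩ := hv
        rw [hcs, List.mem_ofFn] at hc
        obtain ⟨a, rfl⟩ := hc
        exact (hwire _ (hargs a)).2.2.2 hv
    · -- `∨ₖ` gate
      obtain ⟨args, rfl⟩ := Gate.exists_eq_of_fn_eq hc
      have hargs : ∀ a : Fin k, OutOK ms.length (args a) := fun a m hm => hgOK a m hm
      set cs := List.ofFn fun a => wireForm φ (args a) with hcs
      have hfun : ∀ x, (fun a => (wireForm φ (args a)).eval x) = fun a => wireOf x (vals ms x) (args a) :=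
        fun x => funext fun a => (hwire _ (hargs a)).1 x
      refine finish (mkGate true cs) (fun x => ?_) ?_ ?_ ?_
      · rw [eval_mkGate, hcs, List.map_ofFn]
        change combine true (List.ofFn fun a => (wireForm φ (args a)).eval x) = _
        rw [hfun x, combine_ofFn]; rfl
      · refine (height_mkGate_le true cs).trans ?_
        show max 2 (heightList cs + 1) ≤ acWeight (GateFn.or k) + (Finset.univ.sup fun a => wireDepthOf (wdepths acWeight ms) (args a)) + 1
        rw [acWeight_or]
        have : heightList cs ≤ (Finset.univ.sup fun a => wireDepthOf (wdepths acWeight ms) (args a)) + 1 := by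
          refine heightList_le fun c hc => ?_
          rw [hcs, List.mem_ofFn] at hc
          obtain ⟨a, rfl⟩ := hc
          refine (hwire _ (hargs a)).2.1.trans (Nat.add_le_add_right ?_ 1)
          exact Finset.le_sup (f := fun a => wireDepthOf (wdepths acWeight ms) (args a)) (Finset.mem_univ a)
        omega
      · refine width_mkGate_le true fun c hc => ?_
        rw [hcs, List.mem_ofFn] at hc
        obtain ⟨a, rfl⟩ := hc
        exact (hwire _ (hargs a)).2.2.1
      · refine (subG_mkGate_subset true cs).trans (Finset.insert_subset_insert _ fun v hv => ?_)
        rw [mem_subGList] at hv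
        obtain ⟨c, hc, hv⟩ := hv
        rw [hcs, List.mem_ofFn] at hc
        obtain ⟨a, rfl⟩ := hc
        exact (hwire _ (hargs a)).2.2.2 hv

/-- **Circuits over `acBasis` as layered formulas** (Tal 2017, proof of Theorem 3.8: add a dummy
bottom layer of fan-in-`1` gates; De Morgan for the negations of H21's basis): a circuit of
`acDepth` `d` and size `s` computes the same function as a formula of height `≤ d + 1`, bottom
fan-in `1` and effective size `≤ 2s`. [cite: Tal2017, Theorem 3.8] -/
theorem _root_.Literature.Computability.Complexity.Circuit.exists_acForm (C : Circuit (Fin n)) (hC : C.IsOver acBasis) :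
    ∃ f : ACForm n, (∀ x, f.eval x = C.eval x) ∧ f.height ≤ C.acDepth + 1 ∧ f.width ≤ 1 ∧ f.esize ≤ 2 * C.size := by
  obtain ⟨φ, hφ⟩ := exists_forms C.gates (wf_gates C) hC
  have ho : OutOK C.gates.length C.output := C.wf_output
  rcases hCo : C.output with i | m
  · refine ⟨inputForm i, fun x => ?_, by simp [inputForm, height], by simp [inputForm, width], by simp [esize, inputForm, subG]⟩
    rw [circuit_eval, hCo, eval_inputForm]; rfl
  · rw [hCo] at ho
    have hm : m < C.gates.length := ho m rfl
    obtain ⟨h1, h2, h3, h4⟩ := hφ m hm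
    refine ⟨φ m, fun x => ?_, ?_, h3, ?_⟩
    · rw [circuit_eval, hCo, h1]; rfl
    · rw [Circuit.acDepth, circuit_depthWith, hCo]; exact h2
    · unfold esize
      refine (Finset.card_le_card h4).trans ((card_formSet_le φ (m + 1)).trans ?_)
      rw [Circuit.size]; omega

end ACForm


/-! ## Depth one: `∧`/`∨` of literals have `L_{1,k} ≤ 1` -/

namespace ACForm

open LowDegree Literature.Probability.RandomGraphs.LowDegree

/-- Coefficients of `-g`. [cite: ODonnell2014, §1.2] -/
theorem cubeFourierCoeff_neg (g : (Fin n → Bool) → ℝ) (S : Finset (Fin n)) :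
    cubeFourierCoeff (fun x => -g x) S = -cubeFourierCoeff g S := by
  unfold cubeFourierCoeff; rw [← neg_div, ← Finset.sum_neg_distrib]
  congr 1; exact Finset.sum_congr rfl fun x _ => by ring

/-- `L_{1,k}(-g) = L_{1,k}(g)`. [cite: Tal2017, Definition 2.7] -/
theorem l1Level_neg (g : (Fin n → Bool) → ℝ) (k : ℕ) : l1Level (fun x => -g x) k = l1Level g k := by
  unfold l1Level; exact Finset.sum_congr rfl fun S _ => by rw [cubeFourierCoeff_neg, abs_neg]

/-- Coefficient extraction from a Walsh expansion. [cite: ODonnell2014, §1.2] -/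
theorem cubeFourierCoeff_sum_mul_walsh (𝒮 : Finset (Finset (Fin n))) (a : Finset (Fin n) → ℝ) (T : Finset (Fin n)) :
    cubeFourierCoeff (fun x => ∑ S ∈ 𝒮, a S * walsh S x) T = if T ∈ 𝒮 then a T else 0 := by
  classical
  unfold cubeFourierCoeff
  have h2 : (2 : ℝ) ^ n ≠ 0 := by positivity
  rw [div_eq_iff h2]
  simp_rw [Finset.sum_mul]
  rw [Finset.sum_comm]
  have : ∀ S ∈ 𝒮, ∑ x : Fin n → Bool, a S * walsh S x * walsh T x = if S = T then a S * 2 ^ n else 0 := by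
    intro S _
    have e : ∀ x : Fin n → Bool, a S * walsh S x * walsh T x = a S * (walsh S x * walsh T x) := fun x => by ring
    simp_rw [e]
    rw [← Finset.mul_sum, sum_walsh_mul_walsh_index]
    split_ifs <;> simp
  rw [Finset.sum_congr rfl this, Finset.sum_ite_eq']
  split_ifs <;> ring

/-- The spectral norms of a constant: `L_{1,k}(c) ≤ |c|`. [cite: ODonnell2014, §1.2] -/
theorem l1Level_const_le (c : ℝ) (k : ℕ) : l1Level (fun _ : Fin n → Bool => c) k ≤ |c| := by
  unfold l1Level
  rcases Nat.eq_zero_or_pos k with rfl | hk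
  · have e : cubeFourierCoeff (fun _ : Fin n → Bool => c) ∅ = c := by
      rw [cubeFourierCoeff_empty]
      simp only [Finset.sum_const, Finset.card_univ, Fintype.card_fun, Fintype.card_bool, Fintype.card_fin, nsmul_eq_mul,
        Nat.cast_pow, Nat.cast_ofNat]
      field_simp
    rw [Finset.powersetCard_zero, Finset.sum_singleton, e]
  · refine le_trans (le_of_eq (Finset.sum_eq_zero fun S hS => ?_)) (abs_nonneg c)
    rw [Finset.mem_powersetCard] at hS
    have hne : S ≠ ∅ := by rintro rfl; simp at hS; omega
    rw [cubeFourierCoeff_const hne, abs_zero]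

/-- `2 C(v, k) ≤ 2^v` for `v ≥ 1`. [folklore] -/
theorem two_mul_choose_le_two_pow : ∀ {v : ℕ}, 1 ≤ v → ∀ k : ℕ, 2 * v.choose k ≤ 2 ^ v
  | 0, h, _ => absurd h (by omega)
  | 1, _, k => by
    rcases k with _ | _ | k <;> simp [Nat.choose]
  | v + 2, _, 0 => by
    simp only [Nat.choose_zero_right, mul_one]
    calc 2 = 2 ^ 1 := rfl
      _ ≤ 2 ^ (v + 2) := Nat.pow_le_pow_right two_pos (by omega)
  | v + 2, _, k + 1 => by
    rw [Nat.choose_succ_succ', mul_add, pow_succ]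
    have h1 := two_mul_choose_le_two_pow (v := v + 1) (by omega) k
    have h2 := two_mul_choose_le_two_pow (v := v + 1) (by omega) (k + 1)
    omega

/-- The polarity recorded for a variable of the term is that of one of its literals. [folklore] -/
theorem mem_of_polarity {L : Clause (Fin n)} {i : Fin n} (h : ∃ c, (i, c) ∈ L) : (i, polarity L i) ∈ L := by
  unfold polarity
  cases hf : L.find? (fun l => l.1 = i) with
  | none =>
    obtain ⟨c, hc⟩ := h
    have := List.find?_eq_none.1 hf (i, c) hc
    simp at this
  | some l =>
    have hl : l ∈ L := List.mem_of_find?_eq_some hf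
    have hli : l.1 = i := by simpa using List.find?_some hf
    simp only
    have : (i, l.2) = l := by rw [← hli]
    rw [this]; exact hl

/-- A term without complementary literals is the conjunction of `xᵢ = bᵢ` over its variables. [folklore] -/
theorem all_eq_decide_forall {L : Clause (Fin n)} (hL : ¬ ∃ l ∈ L, l.negate ∈ L) (x : Fin n → Bool) :
    L.all (Literal.eval x) = decide (∀ i ∈ (L.map Prod.fst).toFinset, x i = polarity L i) := by
  rw [Bool.eq_iff_iff, List.all_eq_true, decide_eq_true_iff]
  constructor
  · intro h i hi
    rw [List.mem_toFinset, List.mem_map] at hi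
    obtain ⟨l, hl, rfl⟩ := hi
    have hmem := mem_of_polarity (L := L) ⟨l.2, hl⟩
    have := h _ hmem
    simpa [Literal.eval] using this
  · intro h l hl
    have hi : l.1 ∈ (L.map Prod.fst).toFinset := List.mem_toFinset.2 (List.mem_map.2 ⟨l, hl, rfl⟩)
    have hx := h l.1 hi
    have hmem := mem_of_polarity (L := L) ⟨l.2, hl⟩
    have hpol : polarity L l.1 = l.2 := by
      by_contra hne
      apply hL
      refine ⟨l, hl, ?_⟩
      have : polarity L l.1 = !l.2 := by
        cases h1 : polarity L l.1 <;> cases h2 : l.2 <;> simp_all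
      rw [this] at hmem
      exact hmem
    simp [Literal.eval, hx, hpol]

/-- `sgn (¬b) = -sgn b`. [folklore] -/
theorem sgn_not (b : Bool) : sgn (!b) = -sgn b := by cases b <;> simp [sgn]

/-- **`L_{1,k} ≤ 1` for a conjunction of literals** (the depth-one case of Raz–Tal's Lemma 7.1:
for `f = ∧` of literals on `v` distinct variables, `|f̂(S)| = 2^{1-v}` on nonempty `S` inside its
variables, so `L_{1,k} = C(v,k) 2^{1-v} ≤ 1`). [cite: ODonnell2014, §1.2] -/
theorem l1Level_sgn_all_le_one (L : Clause (Fin n)) (k : ℕ) :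
    l1Level (fun x => sgn (L.all (Literal.eval x))) k ≤ 1 := by
  classical
  rcases Nat.eq_zero_or_pos k with rfl | hk
  · exact l1Level_zero_le_one fun x => by unfold sgn; split_ifs <;> norm_num
  by_cases hL : ∃ l ∈ L, l.negate ∈ L
  · obtain ⟨l, h1, h2⟩ := hL
    have : (fun x => sgn (L.all (Literal.eval x))) = fun _ => (1 : ℝ) := by
      funext x; rw [all_eq_false_of_compl h1 h2 x]; rfl
    rw [this]; simpa using l1Level_const_le (n := n) 1 k
  -- no complementary literals: Walsh expansion of the indicator
  set V := (L.map Prod.fst).toFinset with hV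
  set b := polarity L with hb
  set s : Finset (Fin n) → ℝ := fun S => ∏ i ∈ S, sgn (b i) with hs
  have hs1 : ∀ S, |s S| = 1 := fun S => by
    rw [hs, Finset.abs_prod]; exact Finset.prod_eq_one fun i _ => by unfold sgn; split_ifs <;> norm_num
  set a : Finset (Fin n) → ℝ := fun S => (if S = ∅ then 1 else 0) - 2 * s S / 2 ^ V.card with ha
  have hexp : (fun x => sgn (L.all (Literal.eval x))) = fun x => ∑ S ∈ V.powerset, a S * walsh S x := by
    funext x
    rw [all_eq_decide_forall hL x]
    -- the indicator as a product
    have hind : sgn (decide (∀ i ∈ V, x i = b i)) = 1 - 2 * ∏ i ∈ V, (if x i = b i then (1 : ℝ) else 0) := by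
      by_cases h : ∀ i ∈ V, x i = b i
      · rw [decide_eq_true h, Finset.prod_eq_one fun i hi => by rw [if_pos (h i hi)]]; simp [sgn]; norm_num
      · rw [decide_eq_false h]
        push Not at h
        obtain ⟨i, hi, hne⟩ := h
        rw [Finset.prod_eq_zero hi (by rw [if_neg hne])]; simp [sgn]
    have hfac : ∀ i ∈ V, (if x i = b i then (1 : ℝ) else 0) = (1 + sgn (b i) * sgn (x i)) / 2 := by
      intro i _
      by_cases h : x i = b i
      · rw [if_pos h, h, sgn_mul_self]; norm_num
      · rw [if_neg h, sgn_mul_sgn_of_ne (Ne.symm h)]; norm_num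
    have hprod : ∏ i ∈ V, (if x i = b i then (1 : ℝ) else 0) = (∑ S ∈ V.powerset, s S * walsh S x) / 2 ^ V.card := by
      rw [Finset.prod_congr rfl hfac, Finset.prod_div_distrib, Finset.prod_const]
      congr 1
      rw [Finset.prod_congr rfl (fun i _ => add_comm (1 : ℝ) (sgn (b i) * sgn (x i))), Finset.prod_add]
      refine Finset.sum_congr rfl fun S _ => ?_
      rw [Finset.prod_const_one, mul_one, Finset.prod_mul_distrib]; rfl
    rw [hind, hprod]
    -- rewrite `1` as the `∅` term
    simp only [ha, sub_mul, Finset.sum_sub_distrib, ite_mul, one_mul, zero_mul, Finset.sum_ite_eq', Finset.mem_powerset,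
      Finset.empty_subset, if_true, walsh_empty]
    congr 1
    rw [mul_div_assoc', Finset.mul_sum, Finset.sum_div]
    exact Finset.sum_congr rfl fun S _ => by ring
  rw [hexp]
  unfold l1Level
  simp_rw [cubeFourierCoeff_sum_mul_walsh]
  have hpt : ∀ T ∈ univ.powersetCard k, |(if T ∈ V.powerset then a T else 0)| = if T ⊆ V then 2 / 2 ^ V.card else 0 := by
    intro T hT
    rw [Finset.mem_powersetCard] at hT
    have hne : T ≠ ∅ := by rintro rfl; simp at hT; omega
    simp only [Finset.mem_powerset]
    split_ifs with hTV
    · rw [ha]; simp only [if_neg hne, zero_sub, abs_neg, abs_div, abs_mul, abs_two, hs1, mul_one]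
      rw [abs_of_pos (by positivity)]
    · exact abs_zero
  rw [Finset.sum_congr rfl hpt, ← Finset.sum_filter]
  have hfilter : (univ.powersetCard k).filter (fun T : Finset (Fin n) => T ⊆ V) = V.powersetCard k := by
    ext T; simp [Finset.mem_powersetCard, and_comm]
  rw [hfilter, Finset.sum_const, Finset.card_powersetCard, nsmul_eq_mul]
  rcases Nat.eq_zero_or_pos V.card with hv | hv
  · rw [hv, Nat.choose_eq_zero_of_lt hk]; simp
  · have h2 := two_mul_choose_le_two_pow hv k
    have h2' : (2 : ℝ) * V.card.choose k ≤ 2 ^ V.card := by exact_mod_cast h2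
    rw [mul_div_assoc', div_le_one (by positivity)]; linarith

/-- Bottom functions of fan-in one: `L_{1,k} ≤ 1` for every formula of height `≤ 2` and width `≤ 1`
(an `∧`/`∨` of literals, possibly constant). [cite: ODonnell2014, §1.2] -/
theorem l1Level_le_one_of_height_le_two : ∀ (f : ACForm n), f.height ≤ 2 → f.width ≤ 1 → ∀ k,
    l1Level (sgnEval f) k ≤ 1
  | tm false lits, _, _, k => by
    have : sgnEval (tm false lits) = fun x => sgn (lits.all (Literal.eval x)) := by
      funext x; simp [sgnEval]
    rw [this]; exact l1Level_sgn_all_le_one lits k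
  | tm true lits, _, _, k => by
    have : sgnEval (tm true lits) = fun x => -sgn ((lits.map Literal.negate).all (Literal.eval x)) := by
      funext x; rw [sgnEval, eval_tm, if_pos rfl, all_map_negate, sgn_not, neg_neg]
    rw [this, l1Level_neg]; exact l1Level_sgn_all_le_one _ k
  | nf false cls, _, hw, k => by
    rw [width_nf_le_iff] at hw
    by_cases hnil : [] ∈ cls
    · have : sgnEval (nf false cls) = fun _ => (1 : ℝ) := by
        funext x
        rw [sgnEval, eval_nf]
        simp only [Bool.false_eq_true, if_false, CNF.eval]
        rw [show cls.all (fun c => c.any (Literal.eval x)) = false from List.all_eq_false.2 ⟨[], hnil, by simp⟩]; rfl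
      rw [this]; simpa using l1Level_const_le (n := n) 1 k
    · set L := cls.filterMap List.head? with hLdef
      have hcls : ∀ c ∈ cls, ∃ l, c = [l] := by
        intro c hc
        have h1 := hw c hc
        match c, hc, h1 with
        | [], hc, _ => exact absurd hc hnil
        | [l], _, _ => exact ⟨l, rfl⟩
        | _ :: _ :: _, _, h1 => simp at h1
      have : sgnEval (nf false cls) = fun x => sgn (L.all (Literal.eval x)) := by
        funext x
        rw [sgnEval, eval_nf]
        simp only [Bool.false_eq_true, if_false, CNF.eval]
        congr 1
        rw [Bool.eq_iff_iff, List.all_eq_true, List.all_eq_true]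
        constructor
        · intro h l hl
          rw [hLdef, List.mem_filterMap] at hl
          obtain ⟨c, hc, hcl⟩ := hl
          obtain ⟨l', rfl⟩ := hcls c hc
          simp only [List.head?_cons, Option.some.injEq] at hcl; subst hcl
          simpa using h _ hc
        · intro h c hc
          obtain ⟨l, rfl⟩ := hcls c hc
          have : l ∈ L := by rw [hLdef, List.mem_filterMap]; exact ⟨[l], hc, rfl⟩
          simpa using h l this
      rw [this]; exact l1Level_sgn_all_le_one L k
  | nf true cls, _, hw, k => by
    rw [width_nf_le_iff] at hw
    by_cases hnil : [] ∈ cls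
    · have : sgnEval (nf true cls) = fun _ => (-1 : ℝ) := by
        funext x
        rw [sgnEval, eval_nf]
        simp only [if_true, CNF.evalDNF]
        rw [show cls.any (fun c => c.all (Literal.eval x)) = true from List.any_eq_true.2 ⟨[], hnil, by simp⟩]; rfl
      rw [this]; simpa using l1Level_const_le (n := n) (-1) k
    · set L := cls.filterMap List.head? with hLdef
      have hcls : ∀ c ∈ cls, ∃ l, c = [l] := by
        intro c hc
        have h1 := hw c hc
        match c, hc, h1 with
        | [], hc, _ => exact absurd hc hnil
        | [l], _, _ => exact ⟨l, rfl⟩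
        | _ :: _ :: _, _, h1 => simp at h1
      have : sgnEval (nf true cls) = fun x => -sgn ((L.map Literal.negate).all (Literal.eval x)) := by
        funext x
        rw [sgnEval, eval_nf, all_map_negate, sgn_not, neg_neg]
        simp only [if_true, CNF.evalDNF]
        congr 1
        rw [Bool.eq_iff_iff, List.any_eq_true, List.any_eq_true]
        constructor
        · rintro ⟨c, hc, h⟩
          obtain ⟨l, rfl⟩ := hcls c hc
          have : l ∈ L := by rw [hLdef, List.mem_filterMap]; exact ⟨[l], hc, rfl⟩
          exact ⟨l, this, by simpa using h⟩
        · rintro ⟨l, hl, h⟩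
          rw [hLdef, List.mem_filterMap] at hl
          obtain ⟨c, hc, hcl⟩ := hl
          obtain ⟨l', rfl⟩ := hcls c hc
          simp only [List.head?_cons, Option.some.injEq] at hcl; subst hcl
          exact ⟨_, hc, by simpa using h⟩
      rw [this, l1Level_neg]; exact l1Level_sgn_all_le_one _ k
  | gate _ _, h, _, _ => by simp [height] at h

/-! ## Tal's bound for circuits over `acBasis` -/

/-- The absolute constant of the final bound: `c = 15 · 8³ · 16896³`. [cite: Tal2017, Corollary 4.8] -/
def talConst : ℝ := 15 * (cA : ℝ) ^ 3 * (cB : ℝ) ^ 3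

/-- The constant is positive. [folklore] -/
theorem talConst_pos : 0 < talConst := by unfold talConst cA cB B0; positivity

/-- `⌊log₂(2s+1)⌋ ≤ 5 ln s` for `s ≥ 2`. [folklore] -/
theorem logM_two_mul_le {s : ℕ} (hs : 2 ≤ s) : (logM (2 * s) : ℝ) ≤ 5 * Real.log s := by
  have hs' : (2 : ℝ) ≤ s := by exact_mod_cast hs
  have hl2 := Real.log_two_gt_d9
  have hpow : (2 : ℝ) ^ logM (2 * s) ≤ 2 * s + 1 := by
    have := Nat.pow_log_le_self 2 (show 2 * s + 1 ≠ 0 by omega)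
    unfold logM; exact_mod_cast this
  have h1 : (logM (2 * s) : ℝ) * Real.log 2 ≤ Real.log (2 * s + 1) := by
    rw [← Real.log_pow]; exact Real.log_le_log (by positivity) hpow
  have h2 : Real.log (2 * s + 1) ≤ 3 * Real.log s := by
    have e : Real.log ((s : ℝ) ^ 3) = 3 * Real.log s := by rw [Real.log_pow]; norm_num
    rw [← e]
    refine Real.log_le_log (by positivity) ?_
    have hs2 : (4 : ℝ) ≤ (s : ℝ) ^ 2 := by nlinarith
    nlinarith
  have hlogs : 0 ≤ Real.log s := Real.log_nonneg (by linarith)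
  nlinarith

/-- **Tal 2017, Corollary 4.8(3) in H21's circuit model, as quoted by Raz–Tal (Lemma 7.1)**: a
circuit over `acBasis` (unbounded fan-in `∧, ∨`, negations anywhere) of `acDepth ≤ d` and at most
`s ≥ 2` gates computes `f` with `∑_{|S|=k} |f̂(S)| ≤ (c ln s)^{(d-1)k}` for every `k`, with the
absolute constant `c = talConst`; depth `≤ 1` and `k = 0` hold with bound `1` directly. [cite: Tal2017, Corollary 4.8] -/
theorem _root_.Literature.Computability.Complexity.Circuit.l1Level_acBasis_le (C : Circuit (Fin n)) (hC : C.IsOver acBasis) {d s : ℕ}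
    (hd : C.acDepth ≤ d) (hs : C.size ≤ s) (h2 : 2 ≤ s) (k : ℕ) :
    l1Level (fun x => sgn (C.eval x)) k ≤ (talConst * Real.log s) ^ ((d - 1) * k) := by
  obtain ⟨f, hev, hh, hw, hsize⟩ := C.exists_acForm hC
  have hfun : (fun x => sgn (C.eval x)) = sgnEval f := by funext x; rw [sgnEval, hev]
  rw [hfun]
  have hlog : Real.log 2 ≤ Real.log s := Real.log_le_log two_pos (by exact_mod_cast h2)
  have hl2 := Real.log_two_gt_d9
  have hcl : 1 ≤ talConst * Real.log s := by
    have h2c : (2 : ℝ) ≤ talConst := by unfold talConst cA cB B0; norm_num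
    have hlogs : 0.6931471803 < Real.log s := hl2.trans_le hlog
    have := mul_le_mul_of_nonneg_right h2c (le_of_lt (lt_trans (by norm_num) hlogs))
    linarith
  -- trivial cases: `k = 0` or `d ≤ 1`
  rcases Nat.eq_zero_or_pos k with rfl | hk
  · rw [mul_zero, pow_zero]
    exact l1Level_zero_le_one fun x => by unfold sgnEval sgn; split_ifs <;> norm_num
  rcases le_or_gt d 1 with hd1 | hd2
  · have : (d - 1) * k = 0 := by rw [show d - 1 = 0 by omega, zero_mul]
    rw [this, pow_zero]
    exact l1Level_le_one_of_height_le_two f (by omega) hw k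
  -- main case: Theorem 3.6 for the formula of `C`
  have hs1 : 1 ≤ 2 * s := by omega
  have hM : f.esize ≤ 2 * s := hsize.trans (by omega)
  have main := l1Level_le (n := n) hs1 (d := d + 1) (by omega) f (by omega) hM hw hk
  refine main.trans ?_
  rw [show d + 1 - 2 = d - 1 by omega]
  set e := (d - 1) * k with he
  set ℓ : ℝ := (logM (2 * s) : ℝ) with hℓ
  have hℓle : ℓ ≤ 5 * Real.log s := logM_two_mul_le h2
  have hℓ0 : 0 ≤ ℓ := by rw [hℓ]; positivity
  have hke : k ≤ e := by rw [he]; exact Nat.le_mul_of_pos_left k (by omega)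
  have hde : d + 1 ≤ 3 * (d - 1) := by omega
  have hA1 : (1 : ℝ) ≤ cA := by unfold cA; norm_num
  have hB1 : (1 : ℝ) ≤ cB := by unfold cB B0; norm_num
  -- factor the bound
  have hrw : (cA : ℝ) ^ (d + 1) * (2 * ((cB : ℝ) ^ (d + 1) * ℓ ^ (d - 1) / Real.log 2)) ^ k =
      (cA : ℝ) ^ (d + 1) * ((2 / Real.log 2) ^ k * (((cB : ℝ) ^ (d + 1)) ^ k * (ℓ ^ (d - 1)) ^ k)) := by
    rw [show (2 : ℝ) * ((cB : ℝ) ^ (d + 1) * ℓ ^ (d - 1) / Real.log 2) = (2 / Real.log 2) * ((cB : ℝ) ^ (d + 1) * ℓ ^ (d - 1)) by ring]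
    rw [mul_pow, mul_pow]
  rw [hrw]
  have hf1 : (cA : ℝ) ^ (d + 1) ≤ ((cA : ℝ) ^ 3) ^ e := by
    rw [← pow_mul]; exact pow_le_pow_right₀ hA1 (by nlinarith)
  have hf2 : (2 / Real.log 2) ^ k ≤ (3 : ℝ) ^ e := by
    calc (2 / Real.log 2) ^ k ≤ (3 : ℝ) ^ k := pow_le_pow_left₀ (by positivity) (by rw [div_le_iff₀ (by linarith)]; linarith) _
      _ ≤ 3 ^ e := pow_le_pow_right₀ (by norm_num) hke
  have hf3 : ((cB : ℝ) ^ (d + 1)) ^ k ≤ ((cB : ℝ) ^ 3) ^ e := by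
    rw [← pow_mul, ← pow_mul]; exact pow_le_pow_right₀ hB1 (by nlinarith)
  have hf4 : (ℓ ^ (d - 1)) ^ k ≤ (5 * Real.log s) ^ e := by
    rw [← pow_mul, ← he]; exact pow_le_pow_left₀ hℓ0 hℓle _
  calc (cA : ℝ) ^ (d + 1) * ((2 / Real.log 2) ^ k * (((cB : ℝ) ^ (d + 1)) ^ k * (ℓ ^ (d - 1)) ^ k))
      ≤ ((cA : ℝ) ^ 3) ^ e * ((3 : ℝ) ^ e * (((cB : ℝ) ^ 3) ^ e * (5 * Real.log s) ^ e)) := by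
        gcongr
    _ = (talConst * Real.log s) ^ e := by unfold talConst; rw [← mul_pow, ← mul_pow, ← mul_pow]; congr 1; ring

end ACForm

end Literature.Computability.Complexity

end
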